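import Literature.NumberTheory.GaloisRepresentations.PicardLambdaAdicRepDivisible
import Literature.NumberTheory.GaloisRepresentations.CubicJacobiSumPrimary
import Literature.NumberTheory.GaloisRepresentations.ChebotarevFromCyclic
import Literature.NumberTheory.GaloisRepresentations.ChebotarevCyclicProofs
import Literature.NumberTheory.GaloisRepresentations.ChebotarevCyclotomicProofs
import Mathlib.LinearAlgebra.Matrix.Permutation
import HarnessLib

/-!
# Galois representations of Picard curves: the rank of `T₃ J(C_f)` by Chebotarev

Toward `picardCurve_exists_lambdaAdicRep` (Upton 2009, Thm. 2.1 / §4: the `(1 - ω)`-adic representations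
of `Γ_{ℚ(ω)}` attached to the Picard curves `C_f : y³ = f(x)`, `f ∈ ℤ[X]` a quartic separable over `ℚ`).
The conditional theorems of `PicardLambdaAdicRepLocal` / `PicardLambdaAdicRepDivisible` take THREE inputs:
the good-reduction datum (`hX2`, Serre–Tate), the twisted Lefschetz trace formula (`hX3`, Weil/Milne) and a
TORSION input on the geometric Jacobian (`hX1`: `J_f[3ⁿ] ≅ (ℤ/3ⁿ)⁶`, or `hcard`: `#J_f[3ⁿ] = 3^{6n}`, or
`hX1'`: divisibility of `Pic⁰` over `K̄` — each a form of `dim J_f = 3`, Weil/Mumford/Rosen).  This file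
removes the third input for GENERIC `f` and cuts it down to `T₃ J(C_f) ≠ 0` in general, using the tree's
PROVED Chebotarev density theorem (`chebotarev_cyclotomicExtension_holds`,
`FramedGaloisRep.infinite_setOf_frobenius_eq_of_cyclic`):

* **Part A (no count).** For `y³ = f(x)`, `3 ∤ deg f`, over `K̄ ∋ ζ₃` with `J[λ]` finite (`λ = 1 - δ`,
  `δ` a generator of the deck group): `T = T₃ Pic(C_{f,K̄})` is finite free over `ℤ₃`
  (`free_tateModule_of_finite_geomLambdaTorsion`), `ker(θ : T → J[λ]) = λT`, `[T : 3T] = [T : λT]²`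
  (`index_ker_proj_one_eq_sq`), so `rank_{ℤ₃} T = 2r` with `3^r = [T : λT] ≤ #J[λ]`
  (`exists_finrank_eq_two_mul`); and conversely `rank T = 2r` with `#J[λ] = 3^r` forces `θ` onto and, by
  the `λ`-dévissage, `#Pic[3ⁿ] = 3^{2rn}` (`card_torsionBy_pow_eq_of_finrank_eq`).
  [cite: SerreAbelianLadic1968, Ch. I §1.1] [cite: Zarhin2018SuperellipticJacobians, §8]
* **Part B (trace congruences at one good prime).** For the Picard curve over a number field
  `K ⊇ ℚ(ω)` and an arithmetic Frobenius `τ` at a prime over a good place `𝔭 ∤ 3`: the reduction map of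
  `hX2` is bijective on `3`-power torsion WITHOUT any count (`tateModule_map_bijective_of_forall_torsionBy`,
  `picard_trace_frob_deck_of_bij`), so `tr_{ℤ₃}(τ | T) = m ∈ ℤ` with `m = a_𝔭(f) + a_𝔭(f²)`, and the cubic
  character sums give `m ≡ 2 R_𝔭 - 2 (mod 3)`, `R_𝔭 = #{x ∈ k_𝔭 : f̄(x) = 0}` (`picard_trace_frob_congr`;
  `(1 - ω) ∩ ℤ = 3ℤ`); while `m ≡ rank T (mod 3)` as soon as `τ` fixes `J[λ]` pointwise
  (`picard_three_dvd_trace_sub_finrank`: `τ - 1` maps `T` into `λT`, so `(τ - 1)² T ⊆ 3T`).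
  [cite: Upton2009, §2] [cite: IrelandRosen1982, Ch. 9 §3]
* **Part C (Chebotarev and the roots).** Dedekind's dictionary between the Frobenius permutation of the
  roots of `f` in `K̄` and the roots of `f mod 𝔭` (`exists_rootReduction`; `R_𝔭 = 0` if the Frobenius moves
  every root, `R_𝔭 = 4` if it fixes every root), finiteness of the bad places
  (`picard_setOf_badPlace_finite`), triviality on `J[λ] ≅ (𝔽₃^{roots})⁰` of an element fixing the roots
  (`picard_smul_geomLambdaTorsion_eq_of_forall_smul_rootSet_eq`, Schaefer–Zarhin), a fixed-point-free
  element of `Γ_{ℚ(ω)}` when `12 ∣ #Gal(f/ℚ)` (`picard_exists_forall_smul_rootSet_ne`), and Chebotarev for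
  the permutation representation on the roots (`infinite_setOf_exists_isArithFrobAt_smul_rootSet_eq`).
  [cite: NeukirchANT1999, VII Thm. (13.4)] [cite: TateGCFT1967, §2.4]

Consequences (given `hX2`, `hX3` only):
* `picard_finrank_tateModule_eq_zero_or_eq_six`: `rank_{ℤ₃} T₃ J(C_f) ∈ {0, 6}` for every Picard quartic
  (Chebotarev at a totally split good prime: `3 ∣ m`, `3 ∣ m - rank`, `rank = 2r ≤ 6`);
* `picard_finrank_tateModule_eq_six_of_forall_smul_ne`: rank `6` as soon as some `g ∈ Γ_K` moves every
  root (a good prime with `R_𝔭 = 0` has `m ≢ 0`, so `T ≠ 0`) — in particular when `12 ∣ #Gal(f/ℚ)`;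
* `picardCurve_lambdaAdicRep_of_goodReduction_lefschetz_of_twelve_dvd`: for `12 ∣ #Gal(f/ℚ)` ALL clauses
  of `picardCurve_exists_lambdaAdicRep` (existence, unramifiedness, Frobenius traces, absolute
  irreducibility) from `hX2` + `hX3` alone;
* `picardCurve_lambdaAdicRep_of_goodReduction_lefschetz_of_no_root`: the same for every `f` WITHOUT A ROOT in
  `ℚ(ω)` (Dedekind's dictionary counted, `roots_toFinset_card_eq_card_fixed`: `R_𝔭 = #Fix(Frob_𝔭)`; a
  permutation group on `4` letters all of whose elements fix `1` or `4` letters has a common fixed point,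
  `exists_forall_smul_eq_of_card_fixed_mod_three`);
* `picardCurve_lambdaAdicRep_of_goodReduction_lefschetz_of_card_fixed`: the sharp generic form — the same for
  every `f` admitting some `g ∈ Γ_{ℚ(ω)}` with `#Fix(g) ≢ 1 (mod 3)` on the roots;
* `picardCurve_exists_lambdaAdicRep_of_nontrivial_goodReduction_lefschetz`: the full statement from
  `hX2` + `hX3` + (`hX0`) `T₃ Pic(C_{f,K̄}) ≠ 0` — the residual geometric input, needed exactly for the `f`
  with a root in `ℚ(ω)` (Galois group over `ℚ(ω)` equal to `1` or a `C₃` fixing a root: there every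
  Frobenius has `R_𝔭 ∈ {1, 4}` and the congruences cannot see `T`).

All statements are theorems; no named facts are introduced; `hX0`, `hX2`, `hX3` are hypotheses stated in
the tree's vocabulary exactly as in `PicardLambdaAdicRepDivisible`.

## References
* C. Upton, *Galois representations attached to Picard curves*, J. Algebra 322 (2009), §§2–4. [Upton2009]
* J.-P. Serre, *Abelian ℓ-adic representations and elliptic curves* (1968), Ch. I §1.1, §2.
  [SerreAbelianLadic1968]
* J.-P. Serre, J. Tate, *Good reduction of abelian varieties*, Ann. of Math. 88 (1968), §1 Thm. 1.
  [SerreTate1968GoodReduction]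
* J. S. Milne, *Jacobian varieties*, in: Arithmetic Geometry (1986), §11 Prop. 11.2. [Milne1986JacobianVarieties]
* J. Neukirch, *Algebraic Number Theory* (1999), Ch. VII Thm. (13.4) (Chebotarev). [NeukirchANT1999]
* J. Tate, *Global class field theory*, in: Cassels–Fröhlich (1967), §2.4. [TateGCFT1967]
* Yu. G. Zarhin, *Endomorphism algebras of abelian varieties with special reference to superelliptic
  Jacobians* (2018), §§7–8. [Zarhin2018SuperellipticJacobians]
* K. Ireland, M. Rosen, *A Classical Introduction to Modern Number Theory* (1982), Ch. 9 §3. [IrelandRosen1982]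
* D. Mumford, *Abelian Varieties* (1970), §6 Application 2. [MumfordAV1970]
-/

noncomputable section

open Polynomial

namespace Literature.NumberTheory.GaloisRepresentations

open Literature.NumberTheory.EllipticCurves Literature.NumberTheory.DiophantineGeometry
  Literature.NumberTheory.DiophantineGeometry.AlgFunctionField SuperellipticFunctionField Field IsDedekindDomain
open scoped NumberField Pointwise

attribute [local instance] Ideal.Quotient.field

set_option synthInstance.maxHeartbeats 160000

universe u

section NoCount

variable {K : Type u} [Field K] {f : K[X]}
  [Fact (Irreducible (superellipticPoly K (AlgebraicClosure K) 3 f))] {ζ : K}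

/-- **`Pic[3]` is finite as soon as `J[λ]` is**: `λ : Pic[3] → J[λ]` has kernel `J[λ]`. [folklore] -/
theorem finite_torsionBy_three_of_finite_geomLambdaTorsion (hζ : IsPrimitiveRoot ζ 3) (hsep : f.Separable)
    (hndvd : ¬ 3 ∣ f.natDegree) [Finite (geomLambdaTorsion K 3 f)] :
    Finite (AddSubgroup.torsionBy (GeomPic K 3 f) (3 : ℕ)) := by
  classical
  set A₃ : AddSubgroup (GeomPic K 3 f) := AddSubgroup.torsionBy (GeomPic K 3 f) (3 : ℕ) with hA₃
  set ψ : A₃ →+ GeomPic K 3 f := (lamAddMonoidHom hζ).comp A₃.subtype with hψ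
  have hrange : ψ.range ≤ geomLambdaTorsion K 3 f := by
    rintro _ ⟨⟨c, hc⟩, rfl⟩
    exact lamAddMonoidHom_mem_geomLambdaTorsion hζ hsep hndvd hc
  have hle : geomLambdaTorsion K 3 f ≤ A₃ := fun x hx => ((mem_geomLambdaTorsion_iff hζ hsep hndvd x).1 hx).1
  have hker : ψ.ker = (geomLambdaTorsion K 3 f).addSubgroupOf A₃ := by
    ext ⟨x, hx⟩
    rw [AddMonoidHom.mem_ker, AddSubgroup.mem_addSubgroupOf, hψ, AddMonoidHom.comp_apply, AddSubgroup.coe_subtype,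
      mem_geomLambdaTorsion_iff hζ hsep hndvd]
    exact ⟨fun h => ⟨hx, h⟩, fun h => h.2⟩
  haveI : Finite ψ.range := Finite.of_injective _ (AddSubgroup.inclusion_injective hrange)
  haveI : Finite ψ.ker := by
    rw [hker]
    exact Finite.of_equiv _ (AddSubgroup.addSubgroupOfEquivOfLe hle).toEquiv.symm
  have h := AddSubgroup.card_mul_index ψ.ker
  rw [AddSubgroup.index_ker] at h
  refine Nat.finite_of_card_ne_zero ?_
  rw [← h]
  exact mul_ne_zero Nat.card_pos.ne' Nat.card_pos.ne'

/-- `T₃ Pic(C_{f,K̄})` is a finitely generated `ℤ₃`-module as soon as `J[λ]` is finite. [folklore] -/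
theorem finite_tateModule_of_finite_geomLambdaTorsion (hζ : IsPrimitiveRoot ζ 3) (hsep : f.Separable)
    (hndvd : ¬ 3 ∣ f.natDegree) [Finite (geomLambdaTorsion K 3 f)] :
    Module.Finite ℤ_[3] (TateModule (GeomPic K 3 f) 3) :=
  TateModule.finite_of_finite_torsionBy (finite_torsionBy_three_of_finite_geomLambdaTorsion hζ hsep hndvd)

/-- `T₃ Pic(C_{f,K̄})` is a free `ℤ₃`-module as soon as `J[λ]` is finite. [folklore] -/
theorem free_tateModule_of_finite_geomLambdaTorsion (hζ : IsPrimitiveRoot ζ 3) (hsep : f.Separable)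
    (hndvd : ¬ 3 ∣ f.natDegree) [Finite (geomLambdaTorsion K 3 f)] :
    Module.Free ℤ_[3] (TateModule (GeomPic K 3 f) 3) :=
  TateModule.free_of_finite_torsionBy (finite_torsionBy_three_of_finite_geomLambdaTorsion hζ hsep hndvd)

/-- **`λ` is injective on the Tate module** (`3 = -ω²λ²` and `T` is `3`-torsion-free). [folklore] -/
theorem lam_smul_injective (hζ : IsPrimitiveRoot ζ 3) (hsep : f.Separable) (hndvd : ¬ 3 ∣ f.natDegree) :
    letI := tateModulePadicEisenstein f hζ hsep hndvd
    Function.Injective fun t : TateModule (GeomPic K 3 f) 3 => PadicEisenstein.lam • t := by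
  letI := tateModulePadicEisenstein f hζ hsep hndvd
  haveI := isScalarTower_tateModule hζ hsep hndvd
  intro x y hxy
  have h0 : PadicEisenstein.lam • (x - y) = 0 := by
    rw [smul_sub, sub_eq_zero]
    exact hxy
  have h3 : (3 : ℤ_[3]) • (x - y) = 0 := by
    have h : (3 : ℤ_[3]) • (x - y) =
        (PadicEisenstein.lam * -(PadicEisenstein.omega ^ 2)) • (PadicEisenstein.lam • (x - y)) := by
      rw [PadicEisenstein.three_smul_eq, ← mul_smul, ← mul_smul, ← mul_smul]
      congr 1
      ring
    rw [h, h0, smul_zero]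
  have h3' : ((3 : ℕ) : ℤ_[3]) ^ 1 • (x - y) = 0 := by
    rw [pow_one, Nat.cast_ofNat]
    exact h3
  exact sub_eq_zero.1 (TateModule.eq_zero_of_pow_smul_eq_zero h3')

/-- **`ker θ = λT` without any count**: if `(1 - δ)(t mod 3) = 0` then `t = λ s` — `λ t` has vanishing
first component, so `λ t = 3 d = λ (λ (-ω² d))`, and `λ` is injective on `T`.
[cite: Zarhin2018SuperellipticJacobians, §8] -/
theorem exists_lam_smul_eq_of_comp_proj_eq_zero (hζ : IsPrimitiveRoot ζ 3) (hsep : f.Separable)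
    (hndvd : ¬ 3 ∣ f.natDegree) {t : TateModule (GeomPic K 3 f) 3}
    (ht : ((lamAddMonoidHom hζ).comp (TateModule.proj 3 1)) t = 0) :
    letI := tateModulePadicEisenstein f hζ hsep hndvd
    ∃ s : TateModule (GeomPic K 3 f) 3, PadicEisenstein.lam • s = t := by
  letI := tateModulePadicEisenstein f hζ hsep hndvd
  haveI := isScalarTower_tateModule hζ hsep hndvd
  have h0 : TateModule.proj 3 1 (PadicEisenstein.lam • t) = 0 := by
    rw [proj_lam_smul hζ hsep hndvd]
    exact ht
  set d := TateModule.div (PadicEisenstein.lam • t) h0 with hd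
  have h3 : (3 : ℤ_[3]) • d = PadicEisenstein.lam • t := by
    have h := TateModule.p_smul_div _ h0
    rwa [Nat.cast_ofNat] at h
  refine ⟨-(PadicEisenstein.omega ^ 2) • d, lam_smul_injective hζ hsep hndvd ?_⟩
  change PadicEisenstein.lam • (PadicEisenstein.lam • (-(PadicEisenstein.omega ^ 2) • d)) = PadicEisenstein.lam • t
  rw [← PadicEisenstein.three_smul_eq, h3]

/-- `ker θ = λT`, membership form. [folklore] -/
theorem comp_proj_eq_zero_iff (hζ : IsPrimitiveRoot ζ 3) (hsep : f.Separable) (hndvd : ¬ 3 ∣ f.natDegree)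
    (t : TateModule (GeomPic K 3 f) 3) :
    letI := tateModulePadicEisenstein f hζ hsep hndvd
    ((lamAddMonoidHom hζ).comp (TateModule.proj 3 1)) t = 0 ↔
      t ∈ PadicEisenstein.lamSubmodule (TateModule (GeomPic K 3 f) 3) := by
  letI := tateModulePadicEisenstein f hζ hsep hndvd
  rw [PadicEisenstein.mem_lamSubmodule_iff]
  constructor
  · exact exists_lam_smul_eq_of_comp_proj_eq_zero hζ hsep hndvd
  · rintro ⟨s, rfl⟩
    exact comp_proj_lam_smul hζ hsep hndvd s

/-- **`[T : λT] = #θ(T) ≤ #J[λ]`**: `θ` induces `T/λT ↪ J[λ]`. [cite: Zarhin2018SuperellipticJacobians, §8] -/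
theorem index_lamSubmodule_eq_card_range (hζ : IsPrimitiveRoot ζ 3) (hsep : f.Separable) (hndvd : ¬ 3 ∣ f.natDegree) :
    letI := tateModulePadicEisenstein f hζ hsep hndvd
    (PadicEisenstein.lamSubmodule (TateModule (GeomPic K 3 f) 3)).toAddSubgroup.index =
      Nat.card ((lamAddMonoidHom hζ).comp (TateModule.proj 3 1) : TateModule (GeomPic K 3 f) 3 →+ GeomPic K 3 f).range := by
  letI := tateModulePadicEisenstein f hζ hsep hndvd
  have hker : ((lamAddMonoidHom hζ).comp (TateModule.proj 3 1) : TateModule (GeomPic K 3 f) 3 →+ GeomPic K 3 f).ker =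
      (PadicEisenstein.lamSubmodule (TateModule (GeomPic K 3 f) 3)).toAddSubgroup := by
    ext t
    rw [AddMonoidHom.mem_ker, Submodule.mem_toAddSubgroup]
    exact comp_proj_eq_zero_iff hζ hsep hndvd t
  rw [← hker, AddSubgroup.index_ker]

/-- `θ(T) ≤ J[λ]`. [folklore] -/
theorem range_comp_proj_le (hζ : IsPrimitiveRoot ζ 3) (hsep : f.Separable) (hndvd : ¬ 3 ∣ f.natDegree) :
    ((lamAddMonoidHom hζ).comp (TateModule.proj 3 1) : TateModule (GeomPic K 3 f) 3 →+ GeomPic K 3 f).range ≤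
      geomLambdaTorsion K 3 f := by
  rintro _ ⟨t, rfl⟩
  exact comp_proj_mem_geomLambdaTorsion hζ hsep hndvd t

/-! #### `[T : 3ⁿT] = 3^{sn}` and `ker projₙ = 3ⁿ T` -/

/-- **`ker (T → Pic[3ⁿ]) = 3ⁿ T`**. [folklore] -/
theorem proj_eq_zero_iff_exists_pow_smul (n : ℕ) (t : TateModule (GeomPic K 3 f) 3) :
    TateModule.proj 3 n t = 0 ↔ ∃ s : TateModule (GeomPic K 3 f) 3, (3 : ℤ_[3]) ^ n • s = t := by
  constructor
  · induction n generalizing t with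
    | zero =>
      intro _
      exact ⟨t, by rw [pow_zero, one_smul]⟩
    | succ n ih =>
      intro ht
      have h1 : TateModule.proj 3 1 t = 0 := by
        rw [← TateModule.pow_smul_proj_self_add n 1 t, ht, smul_zero]
      have hdiv : TateModule.proj 3 n (TateModule.div t h1) = 0 := by
        rw [TateModule.proj_div]
        exact ht
      obtain ⟨s, hs⟩ := ih _ hdiv
      refine ⟨s, ?_⟩
      have h3 := TateModule.p_smul_div t h1
      rw [Nat.cast_ofNat] at h3
      rw [pow_succ', mul_smul, hs, h3]
  · rintro ⟨s, rfl⟩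
    have h := TateModule.proj_pow_smul (p := 3) n s n
    rw [Nat.cast_ofNat] at h
    rw [h, TateModule.pow_smul_proj]

/-- **`[T : 3ⁿT] = 3^{sn}`** for `T` free of rank `s` over `ℤ₃`: the coordinates modulo `3ⁿ` give
`T/3ⁿT ≅ (ℤ/3ⁿ)^s`. [folklore] -/
theorem card_range_proj_eq_pow (n : ℕ) [Module.Free ℤ_[3] (TateModule (GeomPic K 3 f) 3)]
    [Module.Finite ℤ_[3] (TateModule (GeomPic K 3 f) 3)] :
    Nat.card (TateModule.proj 3 n : TateModule (GeomPic K 3 f) 3 →+ GeomPic K 3 f).range =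
      3 ^ (Module.finrank ℤ_[3] (TateModule (GeomPic K 3 f) 3) * n) := by
  classical
  set T := TateModule (GeomPic K 3 f) 3
  set s := Module.finrank ℤ_[3] T with hs
  let b : Module.Basis (Fin s) ℤ_[3] T := Module.finBasis ℤ_[3] T
  -- the coordinate map modulo `3ⁿ`
  let Φ : T →+ (Fin s → ZMod (3 ^ n)) :=
    { toFun := fun t i => PadicInt.toZModPow n (b.repr t i)
      map_zero' := by ext i; simp
      map_add' := fun x y => by ext i; simp }
  have hΦ : ∀ t i, Φ t i = PadicInt.toZModPow n (b.repr t i) := fun t i => rfl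
  have hsurj : Function.Surjective Φ := by
    intro v
    refine ⟨b.equivFun.symm fun i => ((v i).val : ℤ_[3]), ?_⟩
    ext i
    rw [hΦ, ← Module.Basis.equivFun_apply, LinearEquiv.apply_symm_apply, map_natCast, ZMod.natCast_zmod_val]
  have hker : Φ.ker = (TateModule.proj 3 n : T →+ GeomPic K 3 f).ker := by
    ext t
    rw [AddMonoidHom.mem_ker, AddMonoidHom.mem_ker, proj_eq_zero_iff_exists_pow_smul]
    constructor
    · intro h
      have hcoord : ∀ i, ∃ c : ℤ_[3], b.repr t i = (3 : ℤ_[3]) ^ n * c := fun i => by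
        have hi : Φ t i = 0 := by rw [h]; rfl
        rw [hΦ, ← RingHom.mem_ker, PadicInt.ker_toZModPow, Ideal.mem_span_singleton] at hi
        obtain ⟨c, hc⟩ := hi
        exact ⟨c, by rw [hc, Nat.cast_ofNat]⟩
      choose c hc using hcoord
      refine ⟨∑ i, c i • b i, ?_⟩
      rw [Finset.smul_sum, ← b.sum_repr t]
      refine Finset.sum_congr rfl fun i _ => ?_
      rw [smul_smul, ← hc i]
    · rintro ⟨u, rfl⟩
      ext i
      rw [hΦ, map_smul, Finsupp.smul_apply, smul_eq_mul, map_mul, map_pow]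
      have h3 : PadicInt.toZModPow n (3 : ℤ_[3]) ^ n = 0 := by
        rw [show (3 : ℤ_[3]) = ((3 : ℕ) : ℤ_[3]) by norm_num, map_natCast, ← Nat.cast_pow, ZMod.natCast_self]
      rw [h3, zero_mul]
      rfl
  have h1 : Nat.card Φ.range = Nat.card (Fin s → ZMod (3 ^ n)) := by
    rw [AddMonoidHom.range_eq_top.2 hsurj, AddSubgroup.card_top]
  rw [← AddSubgroup.index_ker, ← hker, AddSubgroup.index_ker, h1, Nat.card_eq_fintype_card, Fintype.card_pi,
    Finset.prod_const, ZMod.card, Finset.card_univ, Fintype.card_fin, ← pow_mul, mul_comm]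

/-! #### `[T : 3T] = [T : λT]²` -/

/-- `λ λ T = 3 T` on the Tate module (`3 = -ω²λ²`, `-ω²` a unit). [folklore] -/
theorem exists_three_smul_eq_lam_lam_smul (hζ : IsPrimitiveRoot ζ 3) (hsep : f.Separable) (hndvd : ¬ 3 ∣ f.natDegree)
    (u : TateModule (GeomPic K 3 f) 3) :
    letI := tateModulePadicEisenstein f hζ hsep hndvd
    (3 : ℤ_[3]) • (-PadicEisenstein.omega • u) = PadicEisenstein.lam • (PadicEisenstein.lam • u) := by
  letI := tateModulePadicEisenstein f hζ hsep hndvd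
  haveI := isScalarTower_tateModule hζ hsep hndvd
  rw [PadicEisenstein.three_smul_eq, ← mul_smul, ← mul_smul, ← mul_smul, ← mul_smul]
  congr 1
  linear_combination (PadicEisenstein.lam ^ 2) * PadicEisenstein.omega_pow_three

/-- **`[T : 3T] = [T : λT]²`**: `λ : T ≃ λT` carries `λT` onto `λλT = 3T`, so `[λT : 3T] = [T : λT]`.
[cite: SerreAbelianLadic1968, Ch. I §1.1] -/
theorem index_ker_proj_one_eq_sq (hζ : IsPrimitiveRoot ζ 3) (hsep : f.Separable) (hndvd : ¬ 3 ∣ f.natDegree) :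
    letI := tateModulePadicEisenstein f hζ hsep hndvd
    (TateModule.proj 3 1 : TateModule (GeomPic K 3 f) 3 →+ GeomPic K 3 f).ker.index =
      (PadicEisenstein.lamSubmodule (TateModule (GeomPic K 3 f) 3)).toAddSubgroup.index ^ 2 := by
  letI := tateModulePadicEisenstein f hζ hsep hndvd
  haveI := isScalarTower_tateModule hζ hsep hndvd
  set T := TateModule (GeomPic K 3 f) 3
  set L : AddSubgroup T := (PadicEisenstein.lamSubmodule T).toAddSubgroup with hL
  set M3 : AddSubgroup T := (TateModule.proj 3 1 : T →+ GeomPic K 3 f).ker with hM3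
  -- multiplication by `λ` as an injective additive endomorphism
  set φ : T →+ T := DistribSMul.toAddMonoidHom T PadicEisenstein.lam with hφ
  have hφapply : ∀ t, φ t = PadicEisenstein.lam • t := fun t => rfl
  have hφinj : Function.Injective φ := fun x y h => lam_smul_injective hζ hsep hndvd h
  have hmemL : ∀ t, t ∈ L ↔ ∃ s, PadicEisenstein.lam • s = t := fun t => by
    rw [hL, Submodule.mem_toAddSubgroup, PadicEisenstein.mem_lamSubmodule_iff]
  have hmemM3 : ∀ t, t ∈ M3 ↔ ∃ s, (3 : ℤ_[3]) • s = t := fun t => by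
    rw [hM3, AddMonoidHom.mem_ker, proj_eq_zero_iff_exists_pow_smul, pow_one]
  -- `M3 ≤ L`
  have hM3L : M3 ≤ L := fun t ht => by
    obtain ⟨s, rfl⟩ := (hmemM3 t).1 ht
    rw [hmemL, PadicEisenstein.three_smul_eq]
    exact ⟨_, rfl⟩
  -- `L = φ.range`, and `L = comap e (M3 inside L)` for `e : T ≃ L`
  have hrange : φ.range = L := by
    ext t
    rw [AddMonoidHom.mem_range, hmemL]
    rfl
  set e : T ≃+ L := (AddMonoidHom.ofInjective hφinj).trans (AddEquiv.addSubgroupCongr hrange) with he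
  have he_apply : ∀ t, ((e t : L) : T) = PadicEisenstein.lam • t := fun t => rfl
  have hcomap : L = (M3.addSubgroupOf L).comap e.toAddMonoidHom := by
    ext t
    rw [AddSubgroup.mem_comap, AddSubgroup.mem_addSubgroupOf, AddEquiv.coe_toAddMonoidHom, he_apply, hmemL, hmemM3]
    constructor
    · rintro ⟨s, rfl⟩
      exact ⟨-PadicEisenstein.omega • s, exists_three_smul_eq_lam_lam_smul hζ hsep hndvd s⟩
    · rintro ⟨s, hs⟩
      refine ⟨-(PadicEisenstein.omega ^ 2) • s, lam_smul_injective hζ hsep hndvd ?_⟩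
      change PadicEisenstein.lam • (PadicEisenstein.lam • (-(PadicEisenstein.omega ^ 2) • s)) = PadicEisenstein.lam • t
      rw [← PadicEisenstein.three_smul_eq, hs]
  have hrel : M3.relIndex L = L.index := by
    rw [AddSubgroup.relIndex]
    conv_rhs => rw [hcomap]
    exact ((M3.addSubgroupOf L).index_comap_of_surjective (f := e.toAddMonoidHom) fun x => e.surjective x).symm
  rw [← AddSubgroup.relIndex_mul_index hM3L, hrel, sq]

/-- **The `ℤ₃`-rank of `T₃ Pic(C_{f,K̄})` is even and `3^{rank/2} = [T : λT] ≤ #J[λ]`.** [cite: Zarhin2018SuperellipticJacobians, §8] -/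
theorem exists_finrank_eq_two_mul (hζ : IsPrimitiveRoot ζ 3) (hsep : f.Separable) (hndvd : ¬ 3 ∣ f.natDegree)
    [Finite (geomLambdaTorsion K 3 f)] :
    letI := tateModulePadicEisenstein f hζ hsep hndvd
    ∃ r : ℕ, Module.finrank ℤ_[3] (TateModule (GeomPic K 3 f) 3) = 2 * r ∧
      (PadicEisenstein.lamSubmodule (TateModule (GeomPic K 3 f) 3)).toAddSubgroup.index = 3 ^ r ∧
      3 ^ r ≤ Nat.card (geomLambdaTorsion K 3 f) := by
  letI := tateModulePadicEisenstein f hζ hsep hndvd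
  haveI := finite_tateModule_of_finite_geomLambdaTorsion hζ hsep hndvd
  haveI := free_tateModule_of_finite_geomLambdaTorsion hζ hsep hndvd
  set s := Module.finrank ℤ_[3] (TateModule (GeomPic K 3 f) 3) with hs
  set a := (PadicEisenstein.lamSubmodule (TateModule (GeomPic K 3 f) 3)).toAddSubgroup.index with ha
  have h3s : (TateModule.proj 3 1 : TateModule (GeomPic K 3 f) 3 →+ GeomPic K 3 f).ker.index = 3 ^ s := by
    rw [AddSubgroup.index_ker, card_range_proj_eq_pow, mul_one]
  have hsq : a ^ 2 = 3 ^ s := by rw [← h3s, index_ker_proj_one_eq_sq hζ hsep hndvd]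
  have hdvd : a ∣ 3 ^ s := Dvd.intro a (by rw [← hsq, sq])
  obtain ⟨r, -, hr⟩ := (Nat.dvd_prime_pow Nat.prime_three).1 hdvd
  refine ⟨r, ?_, hr, ?_⟩
  · rw [hr, ← pow_mul] at hsq
    exact (Nat.pow_right_injective (by norm_num : 2 ≤ 3) hsq).symm.trans (by ring)
  · rw [← hr, ha, index_lamSubmodule_eq_card_range hζ hsep hndvd]
    exact AddSubgroup.card_le_of_le (range_comp_proj_le hζ hsep hndvd)

/-! #### From `θ` onto `J[λ]` to the torsion count -/

/-- The images of the projections `T → Pic[3ⁿ]` increase with `n`. [folklore] -/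
theorem range_proj_mono {m n : ℕ} (hmn : m ≤ n) :
    (TateModule.proj 3 m : TateModule (GeomPic K 3 f) 3 →+ GeomPic K 3 f).range ≤
      (TateModule.proj 3 n : TateModule (GeomPic K 3 f) 3 →+ GeomPic K 3 f).range := by
  rintro _ ⟨t, rfl⟩
  obtain ⟨k, rfl⟩ := exists_add_of_le hmn
  refine ⟨(3 : ℤ_[3]) ^ k • t, ?_⟩
  have h := TateModule.proj_pow_smul (p := 3) k t (m + k)
  rw [Nat.cast_ofNat] at h
  rw [h, add_comm, TateModule.pow_smul_proj_self_add]

/-- If `θ` is onto `J[λ]` then `J[λ]` consists of first components of elements of `T`. [folklore] -/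
theorem geomLambdaTorsion_le_range_proj_one (hζ : IsPrimitiveRoot ζ 3) (hsep : f.Separable) (hndvd : ¬ 3 ∣ f.natDegree)
    (hθ : geomLambdaTorsion K 3 f ≤
      ((lamAddMonoidHom hζ).comp (TateModule.proj 3 1) : TateModule (GeomPic K 3 f) 3 →+ GeomPic K 3 f).range) :
    geomLambdaTorsion K 3 f ≤ (TateModule.proj 3 1 : TateModule (GeomPic K 3 f) 3 →+ GeomPic K 3 f).range := by
  letI := tateModulePadicEisenstein f hζ hsep hndvd
  intro y hy
  obtain ⟨t, rfl⟩ := hθ hy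
  exact ⟨PadicEisenstein.lam • t, proj_lam_smul hζ hsep hndvd t 1⟩

/-- **The `λ`-dévissage**: if `θ` is onto `J[λ]`, every degree-zero class killed by a power of `λ = 1 - δ`
is a component of an element of the Tate module (induction on the power: the set of such components is
`λ`-divisible, as `projₙ t = 3 • projₙ₊₁ t = λλ(-δ² projₙ₊₁ t)`, and contains `J[λ]`).
[cite: SerreAbelianLadic1968, Ch. I §1.1] -/
theorem exists_proj_eq_of_iterate_lamAddMonoidHom_eq_zero (hζ : IsPrimitiveRoot ζ 3) (hsep : f.Separable)
    (hndvd : ¬ 3 ∣ f.natDegree)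
    (hθ : geomLambdaTorsion K 3 f ≤
      ((lamAddMonoidHom hζ).comp (TateModule.proj 3 1) : TateModule (GeomPic K 3 f) 3 →+ GeomPic K 3 f).range)
    (k : ℕ) :
    ∀ a : GeomPic K 3 f, SuperellipticPic.degree K (AlgebraicClosure K) 3 f a = 0 →
      (lamAddMonoidHom hζ)^[k] a = 0 →
        ∃ (n : ℕ) (t : TateModule (GeomPic K 3 f) 3), TateModule.proj 3 n t = a := by
  induction k with
  | zero =>
    intro a _ ha
    rw [Function.iterate_zero, id_eq] at ha
    exact ⟨0, 0, by rw [map_zero, ha]⟩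
  | succ k ih =>
    intro a hdeg ha
    rw [Function.iterate_succ_apply] at ha
    obtain ⟨n, t, ht⟩ := ih _ (degree_lamAddMonoidHom_eq_zero hζ a) ha
    set t' : TateModule (GeomPic K 3 f) 3 := -(deckGen hζ ^ 2 • t) with ht'
    -- `λ λ (proj_{n+1} t') = 3 • proj_{n+1} t = proj_n t = λ a`
    have hb : lamAddMonoidHom hζ (lamAddMonoidHom hζ (TateModule.proj 3 (n + 1) t')) = lamAddMonoidHom hζ a := by
      rw [ht', map_neg, TateModule.proj_smul_of_distribMulAction,
        ← three_smul_eq_lamAddMonoidHom_lamAddMonoidHom hζ hsep hndvd (degree_proj_tateModule (n + 1) t), ← ht]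
      exact TateModule.smul_proj_succ n t
    set b : GeomPic K 3 f := lamAddMonoidHom hζ (TateModule.proj 3 (n + 1) t') with hbdef
    have hb_mem : b ∈ (TateModule.proj 3 (n + 1) : TateModule (GeomPic K 3 f) 3 →+ GeomPic K 3 f).range := by
      letI := tateModulePadicEisenstein f hζ hsep hndvd
      exact ⟨PadicEisenstein.lam • t', proj_lam_smul hζ hsep hndvd t' (n + 1)⟩
    have hab : lamAddMonoidHom hζ (a - b) = 0 := by rw [map_sub, hbdef, hb, sub_self]
    have hdegab : SuperellipticPic.degree K (AlgebraicClosure K) 3 f (a - b) = 0 := by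
      rw [map_sub, hdeg, hbdef, degree_lamAddMonoidHom_eq_zero hζ, sub_self]
    have h3 : (3 • (a - b) : GeomPic K 3 f) = 0 :=
      (geomPic_three_smul_eq_zero_iff hζ hsep hndvd _).2 ⟨hdegab, by rw [hab, map_zero]⟩
    have hmem : a - b ∈ geomLambdaTorsion K 3 f :=
      (mem_geomLambdaTorsion_iff hζ hsep hndvd _).2 ⟨AddSubgroup.torsionBy.nsmul_iff.2 h3, hab⟩
    have h1 : a - b ∈ (TateModule.proj 3 (n + 1) : TateModule (GeomPic K 3 f) 3 →+ GeomPic K 3 f).range :=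
      range_proj_mono (Nat.le_add_left 1 n) (geomLambdaTorsion_le_range_proj_one hζ hsep hndvd hθ hmem)
    obtain ⟨s, hs⟩ := (TateModule.proj 3 (n + 1) : TateModule (GeomPic K 3 f) 3 →+ GeomPic K 3 f).range.add_mem h1 hb_mem
    exact ⟨n + 1, s, by rw [hs, sub_add_cancel]⟩

/-- `λ^{2n}` kills `Pic[3ⁿ]` (`λ² = -3δ` on degree-zero classes). [cite: Zarhin2018SuperellipticJacobians, §8] -/
theorem iterate_lamAddMonoidHom_eq_zero_of_pow_smul_eq_zero (hζ : IsPrimitiveRoot ζ 3) (hsep : f.Separable)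
    (hndvd : ¬ 3 ∣ f.natDegree) (n : ℕ) :
    ∀ a : GeomPic K 3 f, 3 ^ n • a = 0 → (lamAddMonoidHom hζ)^[2 * n] a = 0 := by
  induction n with
  | zero =>
    intro a ha
    rw [pow_zero, one_smul] at ha
    rw [ha, mul_zero, Function.iterate_zero, id_eq]
  | succ n ih =>
    intro a ha
    have hmem : a ∈ AddSubgroup.torsionBy (GeomPic K 3 f) (3 ^ (n + 1) : ℕ) := AddSubgroup.torsionBy.nsmul_iff.2 ha
    have hdeg : SuperellipticPic.degree K (AlgebraicClosure K) 3 f a = 0 :=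
      jacobianTorsion_le_degreeZero K (AlgebraicClosure K) 3 f (pow_ne_zero _ three_ne_zero) hmem
    rw [Nat.mul_succ, Function.iterate_add_apply, Function.iterate_succ_apply, Function.iterate_one,
      lamAddMonoidHom_lamAddMonoidHom_of_degree_eq_zero hζ hsep hndvd hdeg]
    apply ih
    rw [smul_neg, neg_eq_zero, smul_smul, ← pow_succ, smul_comm, ha, smul_zero]

/-- **If `θ` is onto `J[λ]`, the projections `T → Pic[3ⁿ]` are onto.** [cite: SerreAbelianLadic1968, Ch. I §1.1] -/
theorem mem_range_proj_of_geomLambdaTorsion_le (hζ : IsPrimitiveRoot ζ 3) (hsep : f.Separable) (hndvd : ¬ 3 ∣ f.natDegree)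
    (hθ : geomLambdaTorsion K 3 f ≤
      ((lamAddMonoidHom hζ).comp (TateModule.proj 3 1) : TateModule (GeomPic K 3 f) 3 →+ GeomPic K 3 f).range)
    (n : ℕ) {a : GeomPic K 3 f} (ha : a ∈ AddSubgroup.torsionBy (GeomPic K 3 f) (3 ^ n : ℕ)) :
    a ∈ (TateModule.proj 3 n : TateModule (GeomPic K 3 f) 3 →+ GeomPic K 3 f).range := by
  have ha' : 3 ^ n • a = 0 := AddSubgroup.torsionBy.nsmul_iff.1 ha
  have hdeg : SuperellipticPic.degree K (AlgebraicClosure K) 3 f a = 0 :=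
    jacobianTorsion_le_degreeZero K (AlgebraicClosure K) 3 f (pow_ne_zero _ three_ne_zero) ha
  obtain ⟨m, t, rfl⟩ := exists_proj_eq_of_iterate_lamAddMonoidHom_eq_zero hζ hsep hndvd hθ (2 * n) a hdeg
    (iterate_lamAddMonoidHom_eq_zero_of_pow_smul_eq_zero hζ hsep hndvd n a ha')
  rcases le_or_gt m n with hmn | hnm
  · exact range_proj_mono hmn ⟨t, rfl⟩
  · obtain ⟨k, rfl⟩ := exists_add_of_le hnm.le
    have h0 : TateModule.proj 3 k t = 0 := by
      rw [← TateModule.pow_smul_proj_self_add n k t]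
      exact ha'
    obtain ⟨t', rfl⟩ := (proj_eq_zero_iff_exists_pow_smul k t).1 h0
    refine ⟨t', ?_⟩
    have h := TateModule.proj_pow_smul (p := 3) k t' (n + k)
    rw [Nat.cast_ofNat] at h
    rw [h, add_comm n k, TateModule.pow_smul_proj_self_add]

/-- **`#Pic[3ⁿ] = 3^{sn}`** (`s = rank_{ℤ₃} T₃ Pic`) when `θ` is onto `J[λ]`. [cite: SerreAbelianLadic1968, Ch. I §1.1] -/
theorem card_torsionBy_pow_eq_of_geomLambdaTorsion_le (hζ : IsPrimitiveRoot ζ 3) (hsep : f.Separable)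
    (hndvd : ¬ 3 ∣ f.natDegree) [Finite (geomLambdaTorsion K 3 f)]
    (hθ : geomLambdaTorsion K 3 f ≤
      ((lamAddMonoidHom hζ).comp (TateModule.proj 3 1) : TateModule (GeomPic K 3 f) 3 →+ GeomPic K 3 f).range)
    (n : ℕ) :
    Nat.card (AddSubgroup.torsionBy (GeomPic K 3 f) (3 ^ n : ℕ)) =
      3 ^ (Module.finrank ℤ_[3] (TateModule (GeomPic K 3 f) 3) * n) := by
  haveI := finite_tateModule_of_finite_geomLambdaTorsion hζ hsep hndvd
  haveI := free_tateModule_of_finite_geomLambdaTorsion hζ hsep hndvd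
  have hr : (TateModule.proj 3 n : TateModule (GeomPic K 3 f) 3 →+ GeomPic K 3 f).range =
      AddSubgroup.torsionBy (GeomPic K 3 f) (3 ^ n : ℕ) := by
    apply le_antisymm
    · rintro _ ⟨t, rfl⟩
      exact TateModule.proj_mem_torsionBy n t
    · exact fun a ha => mem_range_proj_of_geomLambdaTorsion_le hζ hsep hndvd hθ n ha
  rw [← card_range_proj_eq_pow n, hr]

/-- **The torsion count from the rank**: for `y³ = f(x)`, `3 ∤ deg f`, over `K̄ ∋ ζ₃`, with `#J[λ] = 3^r`: if
`rank_{ℤ₃} T₃ Pic(C_{f,K̄}) = 2r` then `#Pic(C_{f,K̄})[3ⁿ] = 3^{2rn}` for all `n` (so the `3`-primary torsion is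
divisible, `≅ (ℚ₃/ℤ₃)^{2r}`): `[T : λT] = 3^r = #J[λ]` makes `θ : T/λT → J[λ]` onto, and the `λ`-dévissage applies.
[cite: SerreAbelianLadic1968, Ch. I §1.1] [cite: Zarhin2018SuperellipticJacobians, §8] -/
theorem card_torsionBy_pow_eq_of_finrank_eq (hζ : IsPrimitiveRoot ζ 3) (hsep : f.Separable) (hndvd : ¬ 3 ∣ f.natDegree)
    [Finite (geomLambdaTorsion K 3 f)] {r : ℕ} (hlam : Nat.card (geomLambdaTorsion K 3 f) = 3 ^ r)
    (hrank : Module.finrank ℤ_[3] (TateModule (GeomPic K 3 f) 3) = 2 * r) (n : ℕ) :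
    Nat.card (AddSubgroup.torsionBy (GeomPic K 3 f) (3 ^ n : ℕ)) = 3 ^ (2 * r * n) := by
  obtain ⟨r', hr', hidx, -⟩ := exists_finrank_eq_two_mul hζ hsep hndvd
  have hrr : r' = r := by omega
  subst hrr
  have hθ : geomLambdaTorsion K 3 f ≤
      ((lamAddMonoidHom hζ).comp (TateModule.proj 3 1) : TateModule (GeomPic K 3 f) 3 →+ GeomPic K 3 f).range := by
    have hcard : Nat.card ((lamAddMonoidHom hζ).comp (TateModule.proj 3 1) :
        TateModule (GeomPic K 3 f) 3 →+ GeomPic K 3 f).range = Nat.card (geomLambdaTorsion K 3 f) := by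
      rw [← index_lamSubmodule_eq_card_range hζ hsep hndvd, hidx, hlam]
    exact (AddSubgroup.eq_of_le_of_card_ge (range_comp_proj_le hζ hsep hndvd) hcard.ge).ge
  rw [card_torsionBy_pow_eq_of_geomLambdaTorsion_le hζ hsep hndvd hθ n, hrank]

end NoCount

section SpanOneSub

variable {K : Type*} [Field K] [NumberField K] [IsCyclotomicExtension {3} ℚ K] {ζ : 𝓞 K}

/-- **`(1 - ζ) ∩ ℤ = 3ℤ` in `ℤ_K ⊇ ℤ[ζ₃]`**: an integer in the prime ideal `(1 - ζ)` is divisible by `3`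
(else `1 = u·3 + v·n ∈ (1 - ζ)`, but `1 - ζ` is not a unit). [cite: IrelandRosen1982, Ch. 9 §1, Prop. 9.1.4] -/
theorem three_dvd_of_intCast_mem_span_one_sub (hζ : IsPrimitiveRoot ζ 3) {n : ℤ}
    (hn : (n : 𝓞 K) ∈ Ideal.span {1 - ζ}) : (3 : ℤ) ∣ n := by
  by_contra h
  have hcop : IsCoprime (3 : ℤ) n := (Int.prime_three.irreducible.coprime_iff_not_dvd).2 h
  obtain ⟨u, v, huv⟩ := hcop
  have h3 : ((3 : ℤ) : 𝓞 K) ∈ Ideal.span {1 - ζ} := by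
    have := three_mem_span_one_sub hζ
    exact_mod_cast this
  have hmem : (u : 𝓞 K) * ((3 : ℤ) : 𝓞 K) + (v : 𝓞 K) * (n : 𝓞 K) ∈ Ideal.span {1 - ζ} :=
    Ideal.add_mem _ (Ideal.mul_mem_left _ _ h3) (Ideal.mul_mem_left _ _ hn)
  have h' := congrArg (Int.castRingHom (𝓞 K)) huv
  rw [map_add, map_mul, map_mul, map_one, eq_intCast, eq_intCast, eq_intCast, eq_intCast] at h'
  have h1 : (1 : 𝓞 K) ∈ Ideal.span {1 - ζ} := h' ▸ hmem
  exact (prime_one_sub hζ).not_unit (Ideal.span_singleton_eq_top.1 ((Ideal.eq_top_iff_one _).2 h1))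

end SpanOneSub

/-! ## Part B: Frobenius traces on `T₃ J(C_f)` WITHOUT the torsion count -/

section Transfer

/-- **A reduction map bijective on `p`-power torsion induces a bijection of Tate modules**
(Serre–Tate §1 Lemma 2: `A(K̄)[N] ≅ Ã(κ̄)[N]`, passed to the limit). [cite: SerreTate1968GoodReduction, §1 Lemma 2] -/
theorem tateModule_map_bijective_of_forall_torsionBy {A : Type*} [AddCommGroup A] {B : Type*} [AddCommGroup B]
    {p : ℕ} [Fact p.Prime] (red : A →+ B)
    (hinj : ∀ (n : ℕ) (c : A), p ^ n • c = 0 → red c = 0 → c = 0)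
    (hsurj : ∀ (n : ℕ) (c' : B), p ^ n • c' = 0 → ∃ c : A, p ^ n • c = 0 ∧ red c = c') :
    Function.Bijective (TateModule.map p red) := by
  refine ⟨TateModule.map_injective_of_forall_torsionBy red hinj, fun y => ?_⟩
  choose x hx hxred using fun n => hsurj n (TateModule.proj p n y) (TateModule.pow_smul_proj n y)
  have hcompat : ∀ n, p • x (n + 1) = x n := fun n => by
    refine sub_eq_zero.1 (hinj n _ ?_ ?_)
    · rw [smul_sub, hx n, sub_zero, smul_smul, ← pow_succ, hx (n + 1)]
    · rw [map_sub, map_nsmul, hxred, hxred, TateModule.smul_proj_succ, sub_self]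
  refine ⟨TateModule.mk x hx hcompat, TateModule.ext fun n => ?_⟩
  rw [TateModule.proj_map, TateModule.proj_mk, hxred]

end Transfer


/-! ### Separability under the substitution `X ↦ c X` -/

section SepComp

variable {L : Type*} [Field L]

/-- Separability is preserved by the substitution `X ↦ c X`, `c ≠ 0`. [folklore] -/
theorem separable_comp_C_mul_X {p : L[X]} (hp : p.Separable) {c : L} (hc : c ≠ 0) :
    (p.comp (C c * X)).Separable := by
  unfold Separable at hp ⊢
  obtain ⟨u, w, huw⟩ := hp
  rw [derivative_comp, derivative_C_mul, derivative_X, mul_one]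
  refine (isCoprime_mul_unit_left_right (Polynomial.isUnit_C.2 (IsUnit.mk0 c hc)) _ _).2
    ⟨u.comp (C c * X), w.comp (C c * X), ?_⟩
  rw [← mul_comp, ← mul_comp, ← add_comp, huw, one_comp]

/-- If `p(cX)` is separable (`c ≠ 0`) then so is `p`. [folklore] -/
theorem separable_of_separable_comp_C_mul_X {p : L[X]} {c : L} (hc : c ≠ 0)
    (hp : (p.comp (C c * X)).Separable) : p.Separable := by
  have h := separable_comp_C_mul_X hp (inv_ne_zero hc)
  rwa [comp_assoc, mul_comp, C_comp, X_comp, ← mul_assoc, ← C_mul, mul_inv_cancel₀ hc, C_1, one_mul,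
    comp_X] at h

/-- A nonzero constant multiple of a separable polynomial is separable. [folklore] -/
theorem separable_C_mul' {p : L[X]} (hp : p.Separable) {c : L} (hc : c ≠ 0) : (C c * p).Separable := by
  unfold Separable at hp ⊢
  rw [derivative_C_mul]
  exact (isCoprime_mul_unit_left (Polynomial.isUnit_C.2 (IsUnit.mk0 c hc)) _ _).2 hp

end SepComp

/-! ### The monic avatar `F(aX) = a³ f(X)` of an integer quartic -/

section MonicAvatar

/-- The monic integer quartic `F = X⁴ + c₃X³ + a c₂X² + a²c₁X + a³c₀` attached to `f = a X⁴ + c₃X³ + c₂X² + c₁X + c₀`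
satisfies `F(aX) = a³ f(X)`; its roots are `a α` for the roots `α` of `f`. [folklore] -/
theorem exists_monic_comp_C_mul_X_eq (f : ℤ[X]) (h4 : f.natDegree = 4) :
    ∃ F : ℤ[X], F.Monic ∧ F.natDegree = 4 ∧ C f.leadingCoeff ^ 3 * f = F.comp (C f.leadingCoeff * X) := by
  set a := f.leadingCoeff with ha
  set T : ℤ[X] := C (f.coeff 3) * X ^ 3 + C (a * f.coeff 2) * X ^ 2 + C (a ^ 2 * f.coeff 1) * X + C (a ^ 3 * f.coeff 0)
    with hT
  have hTdeg : T.degree < (X ^ 4 : ℤ[X]).degree := by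
    rw [degree_X_pow]
    exact lt_of_le_of_lt (degree_cubic_le) (by exact_mod_cast (by norm_num : (3 : ℕ) < 4))
  refine ⟨X ^ 4 + T, (monic_X_pow 4).add_of_left hTdeg, ?_, ?_⟩
  · rw [natDegree_eq_of_degree_eq_some]
    rw [degree_add_eq_left_of_degree_lt hTdeg, degree_X_pow]
  · have hcoeff : f.coeff 4 = a := by rw [ha, leadingCoeff, h4]
    have hf : f = C (f.coeff 0) + C (f.coeff 1) * X + C (f.coeff 2) * X ^ 2 + C (f.coeff 3) * X ^ 3 + C a * X ^ 4 := by
      conv_lhs => rw [f.as_sum_range_C_mul_X_pow, h4]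
      simp only [Finset.sum_range_succ, Finset.sum_range_zero, zero_add, pow_zero, mul_one, pow_one, hcoeff]
    conv_lhs => rw [hf]
    simp only [hT, add_comp, mul_comp, pow_comp, X_comp, C_comp, map_mul, map_pow]
    ring

end MonicAvatar

/-! ### Reduction of the roots of `f` modulo a prime of `ℤ̄_K` and the arithmetic Frobenius -/

section RootReduction

variable {K : Type*} [Field K] [NumberField K]


/-- **The roots of `f` modulo `𝔓`.**  Let `f ∈ ℤ[X]` be a quartic, separable over `ℚ`, `K` a number field,
`v` a finite place of `K` at which `f mod v` is still a separable quartic, `𝔓 ∣ v` a prime of `ℤ̄_K` and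
`Φ` an arithmetic Frobenius at `𝔓`.  With `a` the leading coefficient of `f`, the algebraic integers
`a α` (`α` a root of `f` in `K̄`) reduce modulo `𝔓` to PAIRWISE DISTINCT elements `r(α)` of `κ(𝔓)`,
`r(Φ α) = r(α)^{N v}`, and for `y` in the residue field `k_v`: `y = r(α)` for some root `α` iff
`ā⁻¹ y` is a root of `f mod v` — Dedekind's dictionary between the Frobenius permutation of the roots and
the roots of the reduction (proved through the monic avatar `F(aX) = a³ f(X)`, whose roots in the domain
`ℤ̄_K` are the `a α`, `Polynomial.roots_map_of_map_ne_zero_of_card_eq_natDegree`). [folklore] -/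
theorem exists_rootReduction (f : ℤ[X]) (h4 : f.natDegree = 4) (hsepQ : (f.map (Int.castRingHom ℚ)).Separable)
    {v : HeightOneSpectrum (𝓞 K)}
    (hdeg : (f.map ((Ideal.Quotient.mk v.asIdeal).comp (algebraMap ℤ (𝓞 K)))).natDegree = 4)
    (hsep : (f.map ((Ideal.Quotient.mk v.asIdeal).comp (algebraMap ℤ (𝓞 K)))).Separable)
    {𝔓 : Ideal (absIntegers (𝓞 K) K)} (h𝔓 : 𝔓 ∈ v.primesAbove)
    {Φ : absoluteGaloisGroup K} (hΦ : IsArithFrobAt (𝓞 K) Φ 𝔓) :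
    haveI := HeightOneSpectrum.isMaximal_of_mem_primesAbove h𝔓
    haveI : 𝔓.LiesOver v.asIdeal := h𝔓.2
    (Ideal.Quotient.mk v.asIdeal (algebraMap ℤ (𝓞 K) f.leadingCoeff) ≠ 0) ∧
    ∃ r : (f.map (algebraMap ℤ K)).rootSet (AlgebraicClosure K) → absIntegers (𝓞 K) K ⧸ 𝔓,
      Function.Injective r ∧
      (∀ α, r (Φ • α) = r α ^ v.residueCard) ∧
      (∀ y : 𝓞 K ⧸ v.asIdeal,
        (∃ α, r α = algebraMap (𝓞 K ⧸ v.asIdeal) (absIntegers (𝓞 K) K ⧸ 𝔓) y) ↔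
          (f.map ((Ideal.Quotient.mk v.asIdeal).comp (algebraMap ℤ (𝓞 K)))).eval
            ((Ideal.Quotient.mk v.asIdeal (algebraMap ℤ (𝓞 K) f.leadingCoeff))⁻¹ * y) = 0) := by
  classical
  haveI := HeightOneSpectrum.isMaximal_of_mem_primesAbove h𝔓
  haveI : 𝔓.LiesOver v.asIdeal := h𝔓.2
  -- notation
  set a : ℤ := f.leadingCoeff with ha
  set fb : (𝓞 K ⧸ v.asIdeal)[X] := f.map ((Ideal.Quotient.mk v.asIdeal).comp (algebraMap ℤ (𝓞 K))) with hfb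
  set ψ : ℤ →+* ((absIntegers (𝓞 K) K) ⧸ 𝔓) := algebraMap ℤ ((absIntegers (𝓞 K) K) ⧸ 𝔓) with hψ
  have hf0 : f ≠ 0 := by rintro rfl; rw [natDegree_zero] at h4; exact absurd h4 (by norm_num)
  have ha0 : a ≠ 0 := leadingCoeff_ne_zero.2 hf0
  -- `ā ≠ 0` in `k`
  set ab : 𝓞 K ⧸ v.asIdeal := Ideal.Quotient.mk v.asIdeal (algebraMap ℤ (𝓞 K) a) with hab
  have hab' : ab = fb.coeff 4 := by rw [hfb, coeff_map, ← h4, coeff_natDegree]; rfl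
  have hab0 : ab ≠ 0 := by
    rw [hab', ← hdeg, coeff_natDegree, Ne, leadingCoeff_eq_zero]
    rintro h0
    rw [h0, natDegree_zero] at hdeg
    exact absurd hdeg (by norm_num)
  refine ⟨hab0, ?_⟩
  -- the monic avatar
  obtain ⟨F, hFm, hF4, hI⟩ := exists_monic_comp_C_mul_X_eq f h4
  -- roots of `f` in `K̄`: `β α = a α` is a root of `F`
  have hroot : ∀ α : (f.map (algebraMap ℤ K)).rootSet (AlgebraicClosure K), aeval (algebraMap ℤ (AlgebraicClosure K) a * (α : (AlgebraicClosure K))) F = 0 := by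
    intro α
    have hα : aeval (α : (AlgebraicClosure K)) f = 0 := by
      have h := (mem_rootSet.1 α.2).2
      rwa [aeval_map_algebraMap] at h
    have h1 : aeval (α : (AlgebraicClosure K)) (C a * X) = algebraMap ℤ (AlgebraicClosure K) a * (α : (AlgebraicClosure K)) := by
      rw [map_mul, aeval_C, aeval_X]
    rw [← h1, ← aeval_comp, ← hI, map_mul, hα, mul_zero]
  have hint : ∀ α : (f.map (algebraMap ℤ K)).rootSet (AlgebraicClosure K), IsIntegral (𝓞 K) (algebraMap ℤ (AlgebraicClosure K) a * (α : (AlgebraicClosure K))) := by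
    intro α
    have h : IsIntegral ℤ (algebraMap ℤ (AlgebraicClosure K) a * (α : (AlgebraicClosure K))) := ⟨F, hFm, by rw [← aeval_def]; exact hroot α⟩
    exact h.tower_top
  -- the integral elements `β α` and their reductions `r α`
  set β : (f.map (algebraMap ℤ K)).rootSet (AlgebraicClosure K) → (absIntegers (𝓞 K) K) := fun α => ⟨algebraMap ℤ (AlgebraicClosure K) a * (α : (AlgebraicClosure K)), (mem_integralClosure_iff (𝓞 K) (AlgebraicClosure K)).2 (hint α)⟩
    with hβ
  have hβval : ∀ α, ((β α : (absIntegers (𝓞 K) K)) : (AlgebraicClosure K)) = algebraMap ℤ (AlgebraicClosure K) a * (α : (AlgebraicClosure K)) := fun α => rfl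
  have hβinj : Function.Injective β := by
    intro α₁ α₂ h
    have h' := congrArg (fun z : (absIntegers (𝓞 K) K) => (z : (AlgebraicClosure K))) h
    simp only [hβval] at h'
    have ha' : (algebraMap ℤ (AlgebraicClosure K) a) ≠ 0 := by
      rw [Ne, map_eq_zero_iff _ (algebraMap ℤ (AlgebraicClosure K)).injective_int]
      exact ha0
    exact Subtype.ext (mul_left_cancel₀ ha' h')
  set r : (f.map (algebraMap ℤ K)).rootSet (AlgebraicClosure K) → (absIntegers (𝓞 K) K) ⧸ 𝔓 := fun α => Ideal.Quotient.mk 𝔓 (β α) with hr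
  -- Frobenius: `r (Φ α) = (r α)^q`
  have hfrob : ∀ α, r (Φ • α) = r α ^ v.residueCard := by
    intro α
    have hsmul : Φ • β α = β (Φ • α) := by
      apply Subtype.ext
      rw [integralClosure.coe_smul, hβval, hβval, rootSet.coe_smul, smul_mul', smul_algebraMap]
    have h := (HeightOneSpectrum.isArithFrobAt_iff_of_mem_primesAbove h𝔓 Φ).1 hΦ (β α)
    rw [hsmul, ← Ideal.Quotient.mk_eq_mk_iff_sub_mem, map_pow] at h
    simp only [hr]
    exact h
  -- `F` over `ℤ̄_K`: its roots are exactly the `β α`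
  set Fz : (absIntegers (𝓞 K) K)[X] := F.map (algebraMap ℤ (absIntegers (𝓞 K) K)) with hFz
  have hFzm : Fz.Monic := hFm.map _
  have hFz4 : Fz.natDegree = 4 := by rw [hFz, hFm.natDegree_map, hF4]
  have hFz0 : Fz ≠ 0 := hFzm.ne_zero
  have hrootz : ∀ α, Fz.IsRoot (β α) := by
    intro α
    rw [IsRoot, ← map_eq_zero_iff _ (FaithfulSMul.algebraMap_injective (absIntegers (𝓞 K) K) (AlgebraicClosure K)), hFz, eval_map, hom_eval₂,
      show (algebraMap (absIntegers (𝓞 K) K) (AlgebraicClosure K)).comp (algebraMap ℤ (absIntegers (𝓞 K) K)) = algebraMap ℤ (AlgebraicClosure K) from RingHom.ext_int _ _]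
    exact hroot α
  set S : Multiset (absIntegers (𝓞 K) K) := (Finset.univ : Finset ((f.map (algebraMap ℤ K)).rootSet (AlgebraicClosure K))).val.map β with hS
  have hSnodup : S.Nodup := Finset.univ.nodup.map hβinj
  have hScard : Multiset.card S = 4 := by
    rw [hS, Multiset.card_map, Finset.card_val, Finset.card_univ, card_rootSet_map_algebraMap_int K h4 hsepQ]
  have hSle : S ≤ Fz.roots := by
    rw [Multiset.le_iff_subset hSnodup]
    intro z hz
    obtain ⟨α, -, rfl⟩ := Multiset.mem_map.1 hz
    exact (mem_roots hFz0).2 (hrootz α)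
  have hroots : Fz.roots = S :=
    (Multiset.eq_of_le_of_card_le hSle (by rw [hScard, ← hFz4]; exact card_roots' Fz)).symm
  have hrootscard : Multiset.card Fz.roots = Fz.natDegree := by rw [hroots, hScard, hFz4]
  -- reduction: the roots of `F mod 𝔓` are the `r α`
  set Fκ : ((absIntegers (𝓞 K) K) ⧸ 𝔓)[X] := Fz.map (Ideal.Quotient.mk 𝔓) with hFκ
  have hFκroots : Fκ.roots = (Finset.univ : Finset ((f.map (algebraMap ℤ K)).rootSet (AlgebraicClosure K))).val.map r := by
    rw [hFκ, ← roots_map_of_map_ne_zero_of_card_eq_natDegree _ (map_monic_ne_zero hFzm) hrootscard, hroots, hS,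
      Multiset.map_map]
    rfl
  have hFκ0 : Fκ ≠ 0 := map_monic_ne_zero hFzm
  -- `F mod 𝔓 = F.map ψ`, `f̄ ⊗ κ = f.map ψ`, `ψ a = ā`, and the identity `ā³ f = F(ā X)` over `κ`
  have hFκ' : Fκ = F.map ψ := by
    rw [hFκ, hFz, Polynomial.map_map]
    congr 1
  have hfκ : fb.map (algebraMap (𝓞 K ⧸ v.asIdeal) ((absIntegers (𝓞 K) K) ⧸ 𝔓)) = f.map ψ := by
    rw [hfb, Polynomial.map_map]
    congr 1
  have hψa : ψ a = algebraMap (𝓞 K ⧸ v.asIdeal) ((absIntegers (𝓞 K) K) ⧸ 𝔓) ab := by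
    rw [hab, hψ, ← Ideal.Quotient.algebraMap_eq, ← IsScalarTower.algebraMap_apply, ← IsScalarTower.algebraMap_apply,
      IsScalarTower.algebraMap_apply ℤ (𝓞 K) ((absIntegers (𝓞 K) K) ⧸ 𝔓)]
  have hψa0 : ψ a ≠ 0 := by
    rw [hψa, Ne, map_eq_zero_iff _ (algebraMap (𝓞 K ⧸ v.asIdeal) ((absIntegers (𝓞 K) K) ⧸ 𝔓)).injective]
    exact hab0
  have hIκ : C (ψ a) ^ 3 * f.map ψ = (F.map ψ).comp (C (ψ a) * X) := by
    have h := congrArg (Polynomial.map ψ) hI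
    rwa [Polynomial.map_mul, Polynomial.map_pow, map_C, Polynomial.map_comp, Polynomial.map_mul, map_C, map_X] at h
  -- `F mod 𝔓` is separable, so `r` is injective
  have hFκsep : Fκ.Separable := by
    rw [hFκ']
    refine separable_of_separable_comp_C_mul_X hψa0 ?_
    rw [← hIκ, ← C_pow, ← hfκ]
    exact separable_C_mul' hsep.map (pow_ne_zero 3 hψa0)
  have hrinj : Function.Injective r := by
    have hnd : ((Finset.univ : Finset ((f.map (algebraMap ℤ K)).rootSet (AlgebraicClosure K))).val.map r).Nodup := by
      rw [← hFκroots]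
      exact nodup_roots hFκsep
    rw [Multiset.nodup_map_iff_inj_on Finset.univ.nodup] at hnd
    exact fun α₁ α₂ h => hnd α₁ (Finset.mem_univ _) α₂ (Finset.mem_univ _) h
  refine ⟨r, hrinj, hfrob, fun y => ?_⟩
  -- the dictionary for `y ∈ k`
  have hy : (∃ α, r α = algebraMap (𝓞 K ⧸ v.asIdeal) ((absIntegers (𝓞 K) K) ⧸ 𝔓) y) ↔ Fκ.eval (algebraMap (𝓞 K ⧸ v.asIdeal) ((absIntegers (𝓞 K) K) ⧸ 𝔓) y) = 0 := by
    rw [← IsRoot, ← mem_roots hFκ0, hFκroots, Multiset.mem_map]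
    simp only [Finset.mem_val, Finset.mem_univ, true_and, hr]
  rw [hy, hFκ', ← map_eq_zero_iff _ (algebraMap (𝓞 K ⧸ v.asIdeal) ((absIntegers (𝓞 K) K) ⧸ 𝔓)).injective, ← eval₂_at_apply, ← eval_map,
    hfκ, map_mul, map_inv₀, ← hψa]
  have h2 : ((F.map ψ).comp (C (ψ a) * X)).eval ((ψ a)⁻¹ * algebraMap (𝓞 K ⧸ v.asIdeal) ((absIntegers (𝓞 K) K) ⧸ 𝔓) y) =
      (F.map ψ).eval (algebraMap (𝓞 K ⧸ v.asIdeal) ((absIntegers (𝓞 K) K) ⧸ 𝔓) y) := by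
    rw [eval_comp, eval_mul, eval_C, eval_X, ← mul_assoc, mul_inv_cancel₀ hψa0, one_mul]
  rw [← h2, ← hIκ, eval_mul, eval_pow, eval_C, mul_eq_zero, or_iff_right (pow_ne_zero 3 hψa0)]

end RootReduction

section RootReductionCor

variable {K : Type*} [Field K] [NumberField K]

/-- **A Frobenius moving every root ⇒ `f mod v` has no root in `k_v`.** [folklore] -/
theorem roots_toFinset_card_eq_zero_of_forall_smul_ne (f : ℤ[X]) (h4 : f.natDegree = 4)
    (hsepQ : (f.map (Int.castRingHom ℚ)).Separable) {v : HeightOneSpectrum (𝓞 K)}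
    (hdeg : (f.map ((Ideal.Quotient.mk v.asIdeal).comp (algebraMap ℤ (𝓞 K)))).natDegree = 4)
    (hsep : (f.map ((Ideal.Quotient.mk v.asIdeal).comp (algebraMap ℤ (𝓞 K)))).Separable)
    {𝔓 : Ideal (absIntegers (𝓞 K) K)} (h𝔓 : 𝔓 ∈ v.primesAbove)
    {Φ : absoluteGaloisGroup K} (hΦ : IsArithFrobAt (𝓞 K) Φ 𝔓)
    (hfix : ∀ α : (f.map (algebraMap ℤ K)).rootSet (AlgebraicClosure K), Φ • α ≠ α) [DecidableEq (𝓞 K ⧸ v.asIdeal)] :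
    (f.map ((Ideal.Quotient.mk v.asIdeal).comp (algebraMap ℤ (𝓞 K)))).roots.toFinset.card = 0 := by
  classical
  haveI := HeightOneSpectrum.isMaximal_of_mem_primesAbove h𝔓
  haveI : 𝔓.LiesOver v.asIdeal := h𝔓.2
  letI : Fintype (𝓞 K ⧸ v.asIdeal) := Fintype.ofFinite _
  have hq : v.residueCard = Fintype.card (𝓞 K ⧸ v.asIdeal) := by
    rw [HeightOneSpectrum.residueCard_eq_card_quotient, Nat.card_eq_fintype_card]
  obtain ⟨hab0, r, hrinj, hfrob, hdict⟩ := exists_rootReduction f h4 hsepQ hdeg hsep h𝔓 hΦ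
  set fb := f.map ((Ideal.Quotient.mk v.asIdeal).comp (algebraMap ℤ (𝓞 K))) with hfb
  have hfb0 : fb ≠ 0 := by
    intro h0
    rw [h0, natDegree_zero] at hdeg
    exact absurd hdeg (by norm_num)
  rw [Finset.card_eq_zero, Multiset.toFinset_eq_empty]
  refine Multiset.eq_zero_of_forall_notMem fun x hx => ?_
  rw [mem_roots hfb0, IsRoot] at hx
  set ab := Ideal.Quotient.mk v.asIdeal (algebraMap ℤ (𝓞 K) f.leadingCoeff) with hab
  obtain ⟨α, hα⟩ := (hdict (ab * x)).2 (by rwa [← mul_assoc, inv_mul_cancel₀ hab0, one_mul])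
  have hfixα : r (Φ • α) = r α := by
    rw [hfrob, hα, ← map_pow, hq, FiniteField.pow_card]
  exact hfix α (hrinj hfixα)

/-- **A Frobenius fixing every root ⇒ `f mod v` has `4` roots in `k_v`.** [folklore] -/
theorem roots_toFinset_card_eq_four_of_forall_smul_eq (f : ℤ[X]) (h4 : f.natDegree = 4)
    (hsepQ : (f.map (Int.castRingHom ℚ)).Separable) {v : HeightOneSpectrum (𝓞 K)}
    (hdeg : (f.map ((Ideal.Quotient.mk v.asIdeal).comp (algebraMap ℤ (𝓞 K)))).natDegree = 4)
    (hsep : (f.map ((Ideal.Quotient.mk v.asIdeal).comp (algebraMap ℤ (𝓞 K)))).Separable)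
    {𝔓 : Ideal (absIntegers (𝓞 K) K)} (h𝔓 : 𝔓 ∈ v.primesAbove)
    {Φ : absoluteGaloisGroup K} (hΦ : IsArithFrobAt (𝓞 K) Φ 𝔓)
    (hfix : ∀ α : (f.map (algebraMap ℤ K)).rootSet (AlgebraicClosure K), Φ • α = α) [DecidableEq (𝓞 K ⧸ v.asIdeal)] :
    (f.map ((Ideal.Quotient.mk v.asIdeal).comp (algebraMap ℤ (𝓞 K)))).roots.toFinset.card = 4 := by
  classical
  haveI := HeightOneSpectrum.isMaximal_of_mem_primesAbove h𝔓
  haveI : 𝔓.LiesOver v.asIdeal := h𝔓.2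
  letI : Fintype (𝓞 K ⧸ v.asIdeal) := Fintype.ofFinite _
  have hq : v.residueCard = Fintype.card (𝓞 K ⧸ v.asIdeal) := by
    rw [HeightOneSpectrum.residueCard_eq_card_quotient, Nat.card_eq_fintype_card]
  obtain ⟨hab0, r, hrinj, hfrob, hdict⟩ := exists_rootReduction f h4 hsepQ hdeg hsep h𝔓 hΦ
  set fb := f.map ((Ideal.Quotient.mk v.asIdeal).comp (algebraMap ℤ (𝓞 K))) with hfb
  have hfb0 : fb ≠ 0 := by
    intro h0
    rw [h0, natDegree_zero] at hdeg
    exact absurd hdeg (by norm_num)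
  set ab := Ideal.Quotient.mk v.asIdeal (algebraMap ℤ (𝓞 K) f.leadingCoeff) with hab
  -- every `r α` is `k_v`-rational
  have hpow : ∀ α, r α ^ Fintype.card (𝓞 K ⧸ v.asIdeal) = r α := fun α => by
    rw [← hq, ← hfrob, hfix]
  choose y hy using fun α => SuperellipticFunctionField.exists_eq_algebraMap_of_pow_card_eq (hpow α)
  set x : (f.map (algebraMap ℤ K)).rootSet (AlgebraicClosure K) → 𝓞 K ⧸ v.asIdeal := fun α => ab⁻¹ * y α with hxdef
  have hx : ∀ α, fb.eval (x α) = 0 := fun α => (hdict (y α)).1 ⟨α, (hy α).symm⟩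
  have hxinj : Function.Injective x := by
    intro α₁ α₂ h
    have h' : y α₁ = y α₂ := mul_left_cancel₀ (inv_ne_zero hab0) h
    apply hrinj
    rw [← hy, ← hy, h']
  apply le_antisymm
  · calc fb.roots.toFinset.card ≤ Multiset.card fb.roots := Multiset.toFinset_card_le _
      _ ≤ fb.natDegree := card_roots' _
      _ = 4 := hdeg
  · have himg : Finset.univ.image x ⊆ fb.roots.toFinset := by
      intro z hz
      obtain ⟨α, -, rfl⟩ := Finset.mem_image.1 hz
      rw [Multiset.mem_toFinset, mem_roots hfb0]
      exact hx α
    calc 4 = Fintype.card ((f.map (algebraMap ℤ K)).rootSet (AlgebraicClosure K)) := (card_rootSet_map_algebraMap_int K h4 hsepQ).symm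
      _ = (Finset.univ.image x).card := by rw [Finset.card_image_of_injective _ hxinj, Finset.card_univ]
      _ ≤ _ := Finset.card_le_card himg

/-- **Dedekind's dictionary, counted**: the number of roots of `f mod v` in `k_v` is the number of roots of `f`
in `K̄` fixed by an arithmetic Frobenius `Φ` at `𝔓 ∣ v`. [folklore] -/
theorem roots_toFinset_card_eq_card_fixed (f : ℤ[X]) (h4 : f.natDegree = 4)
    (hsepQ : (f.map (Int.castRingHom ℚ)).Separable) {v : HeightOneSpectrum (𝓞 K)}
    (hdeg : (f.map ((Ideal.Quotient.mk v.asIdeal).comp (algebraMap ℤ (𝓞 K)))).natDegree = 4)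
    (hsep : (f.map ((Ideal.Quotient.mk v.asIdeal).comp (algebraMap ℤ (𝓞 K)))).Separable)
    {𝔓 : Ideal (absIntegers (𝓞 K) K)} (h𝔓 : 𝔓 ∈ v.primesAbove)
    {Φ : absoluteGaloisGroup K} (hΦ : IsArithFrobAt (𝓞 K) Φ 𝔓) [DecidableEq (𝓞 K ⧸ v.asIdeal)] :
    (f.map ((Ideal.Quotient.mk v.asIdeal).comp (algebraMap ℤ (𝓞 K)))).roots.toFinset.card =
      Nat.card {α : (f.map (algebraMap ℤ K)).rootSet (AlgebraicClosure K) // Φ • α = α} := by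
  classical
  rw [Nat.card_eq_fintype_card, Fintype.card_subtype]
  haveI := HeightOneSpectrum.isMaximal_of_mem_primesAbove h𝔓
  haveI : 𝔓.LiesOver v.asIdeal := h𝔓.2
  letI : Fintype (𝓞 K ⧸ v.asIdeal) := Fintype.ofFinite _
  have hq : v.residueCard = Fintype.card (𝓞 K ⧸ v.asIdeal) := by
    rw [HeightOneSpectrum.residueCard_eq_card_quotient, Nat.card_eq_fintype_card]
  obtain ⟨hab0, r, hrinj, hfrob, hdict⟩ := exists_rootReduction f h4 hsepQ hdeg hsep h𝔓 hΦ
  set fb := f.map ((Ideal.Quotient.mk v.asIdeal).comp (algebraMap ℤ (𝓞 K))) with hfb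
  have hfb0 : fb ≠ 0 := by
    intro h0
    rw [h0, natDegree_zero] at hdeg
    exact absurd hdeg (by norm_num)
  set ab := Ideal.Quotient.mk v.asIdeal (algebraMap ℤ (𝓞 K) f.leadingCoeff) with hab
  have hinjk : Function.Injective (algebraMap (𝓞 K ⧸ v.asIdeal) (absIntegers (𝓞 K) K ⧸ 𝔓)) := RingHom.injective _
  -- a fixed root `α` has `r α ∈ k_v`: `r α = y α`
  have key : ∀ α : (f.map (algebraMap ℤ K)).rootSet (AlgebraicClosure K), Φ • α = α →
      ∃ y : 𝓞 K ⧸ v.asIdeal, r α = algebraMap _ _ y := fun α hα => by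
    have hpow : r α ^ Fintype.card (𝓞 K ⧸ v.asIdeal) = r α := by rw [← hq, ← hfrob, hα]
    obtain ⟨y, hy⟩ := SuperellipticFunctionField.exists_eq_algebraMap_of_pow_card_eq hpow
    exact ⟨y, hy.symm⟩
  choose y hy using key
  symm
  refine Finset.card_bij (fun α hα => ab⁻¹ * y α (Finset.mem_filter.1 hα).2) (fun α hα => ?_)
    (fun α₁ hα₁ α₂ hα₂ h => ?_) (fun x hx => ?_)
  · -- lands in the roots of `f mod v`
    rw [Multiset.mem_toFinset, mem_roots hfb0, IsRoot]
    exact (hdict _).1 ⟨α, hy α _⟩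
  · -- injective
    have h' := mul_left_cancel₀ (inv_ne_zero hab0) h
    apply hrinj
    rw [hy α₁ (Finset.mem_filter.1 hα₁).2, hy α₂ (Finset.mem_filter.1 hα₂).2, h']
  · -- surjective
    rw [Multiset.mem_toFinset, mem_roots hfb0, IsRoot] at hx
    obtain ⟨α, hα⟩ := (hdict (ab * x)).2 (by rwa [← mul_assoc, inv_mul_cancel₀ hab0, one_mul])
    have hfixα : Φ • α = α := by
      apply hrinj
      rw [hfrob, hα, ← map_pow, hq, FiniteField.pow_card]
    refine ⟨α, Finset.mem_filter.2 ⟨Finset.mem_univ _, hfixα⟩, ?_⟩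
    show ab⁻¹ * y α hfixα = x
    have h2 : algebraMap _ _ (y α hfixα) = algebraMap (𝓞 K ⧸ v.asIdeal) (absIntegers (𝓞 K) K ⧸ 𝔓) (ab * x) :=
      (hy α hfixα).symm.trans hα
    rw [hinjk h2, ← mul_assoc, inv_mul_cancel₀ hab0, one_mul]

end RootReductionCor


/-! ### C1: an element fixing the roots acts trivially on `J_f[1 - ω]` -/

section RootsFixed

variable (K : Type*) [Field K] [NumberField K] [IsCyclotomicExtension {3} ℚ K]

/-- If `τ ∈ Γ_K` fixes every root of `f_K` in `K̄`, then `τ` acts trivially on `J_f[1 - ω]`: by the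
Schaefer–Zarhin isomorphism `J_f[1 - ω] ≅ (𝔽₃^{roots})⁰⁰` (`picard_lambdaTorsion_iso_heart`) the action of
`Γ_K` on `J_f[1 - ω]` factors through the permutation action on the roots.
[cite: Zarhin2018SuperellipticJacobians, §8 (0)–(i)] -/
theorem picard_smul_geomLambdaTorsion_eq_of_forall_smul_rootSet_eq (f : ℤ[X]) (h4 : f.natDegree = 4)
    (hsep : (f.map (Int.castRingHom ℚ)).Separable) (τ : absoluteGaloisGroup K)
    (hτ : ∀ x : (f.map (algebraMap ℤ K)).rootSet (AlgebraicClosure K), τ • x = x) :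
    haveI := fact_irreducible_superellipticPoly_picard K h4 hsep
    ∀ y ∈ geomLambdaTorsion K 3 (f.map (algebraMap ℤ K)), τ • y = y := by
  haveI := fact_irreducible_superellipticPoly_picard K h4 hsep
  obtain ⟨Ψ, -, hΨrange, hΨequiv⟩ := picard_lambdaTorsion_iso_heart K f h4 hsep
  intro y hy
  rw [← hΨrange] at hy
  obtain ⟨v, rfl⟩ := hy
  rw [← hΨequiv]
  congr 1
  obtain ⟨x, rfl⟩ := Submodule.Quotient.mk_surjective _ v
  rw [heartRep_mk]
  congr 1
  apply Subtype.ext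
  rw [coe_augmentationRep_apply]
  ext z
  rw [permRep_apply_apply]
  congr 1
  rw [inv_smul_eq_iff, hτ]

end RootsFixed

/-! ### C3: almost all places of `K` are good for `f` -/

section BadPlaces

/-- Clearing denominators in a rational polynomial. [folklore] -/
private theorem exists_map_int_eq_C_mul (a : ℚ[X]) :
    ∃ (n : ℤ) (A : ℤ[X]), n ≠ 0 ∧ A.map (Int.castRingHom ℚ) = C (n : ℚ) * a := by
  obtain ⟨b, hb, hA⟩ := IsLocalization.integerNormalization_spec (nonZeroDivisors ℤ) a
  refine ⟨b, IsLocalization.integerNormalization (nonZeroDivisors ℤ) a, nonZeroDivisors.ne_zero hb, ?_⟩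
  rw [← IsScalarTower.algebraMap_smul ℚ b a, smul_eq_C_mul] at hA
  simpa using hA

/-- **Bézout identity with integer coefficients** for an integer polynomial separable over `ℚ`:
`A f + B f' = N` with `N ∈ ℤ ∖ {0}`. [folklore] -/
private theorem exists_bezout_int (f : ℤ[X]) (hsep : (f.map (Int.castRingHom ℚ)).Separable) :
    ∃ (N : ℤ) (A B : ℤ[X]), N ≠ 0 ∧ A * f + B * derivative f = C N := by
  unfold Separable at hsep
  obtain ⟨a, b, hab⟩ := hsep
  obtain ⟨m, A, hm, hA⟩ := exists_map_int_eq_C_mul a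
  obtain ⟨n, B, hn, hB⟩ := exists_map_int_eq_C_mul b
  refine ⟨m * n, C n * A, C m * B, mul_ne_zero hm hn, ?_⟩
  apply Polynomial.map_injective (Int.castRingHom ℚ) (RingHom.injective_int _)
  rw [Polynomial.derivative_map] at hab
  simp only [Polynomial.map_add, Polynomial.map_mul, map_C, hA, hB]
  simp only [eq_intCast, Int.cast_mul, C_mul]
  linear_combination (C (m : ℚ) * C (n : ℚ)) * hab

variable {K : Type*} [Field K] [NumberField K]

/-- **Almost all places of `K` are good for `f`**: for an integer quartic `f`, separable over `ℚ`, all but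
finitely many finite places `v` of `K` satisfy `v ∤ 3`, `deg (f mod v) = 4` and `f mod v` separable
(the exceptions divide `3 · N · lc(f)` with `A f + B f' = N` a Bézout identity over `ℤ`). [folklore] -/
theorem picard_setOf_badPlace_finite (f : ℤ[X]) (h4 : f.natDegree = 4)
    (hsep : (f.map (Int.castRingHom ℚ)).Separable) :
    {v : HeightOneSpectrum (𝓞 K) | ¬ ((3 : 𝓞 K) ∉ v.asIdeal ∧
      (f.map ((Ideal.Quotient.mk v.asIdeal).comp (algebraMap ℤ (𝓞 K)))).natDegree = 4 ∧
      (f.map ((Ideal.Quotient.mk v.asIdeal).comp (algebraMap ℤ (𝓞 K)))).Separable)}.Finite := by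
  obtain ⟨N, A, B, hN, hAB⟩ := exists_bezout_int f hsep
  have hlc : f.leadingCoeff ≠ 0 := by
    rw [Ne, leadingCoeff_eq_zero]
    rintro rfl
    simp at h4
  set M : ℤ := 3 * N * f.leadingCoeff with hM
  have hM0 : algebraMap ℤ (𝓞 K) M ≠ 0 := by
    rw [Ne, map_eq_zero_iff _ (algebraMap ℤ (𝓞 K)).injective_int]
    exact mul_ne_zero (mul_ne_zero (by norm_num) hN) hlc
  have hI : (Ideal.span {algebraMap ℤ (𝓞 K) M} : Ideal (𝓞 K)) ≠ ⊥ := by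
    rwa [Ne, Ideal.span_singleton_eq_bot]
  refine (Ideal.finite_factors hI).subset ?_
  intro v hv
  rw [Set.mem_setOf_eq, Ideal.dvd_span_singleton]
  by_contra hMv
  apply hv
  set φ := (Ideal.Quotient.mk v.asIdeal).comp (algebraMap ℤ (𝓞 K)) with hφ
  have hφM : φ M ≠ 0 := by
    rwa [hφ, RingHom.comp_apply, Ne, Ideal.Quotient.eq_zero_iff_mem]
  simp only [hM, map_mul] at hφM
  have h3 := left_ne_zero_of_mul (left_ne_zero_of_mul hφM)
  have hNv := right_ne_zero_of_mul (left_ne_zero_of_mul hφM)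
  have hlcv := right_ne_zero_of_mul hφM
  refine ⟨?_, ?_, ?_⟩
  · intro h3v
    apply h3
    rw [hφ, RingHom.comp_apply, map_ofNat, Ideal.Quotient.eq_zero_iff_mem]
    exact h3v
  · rw [natDegree_map_of_leadingCoeff_ne_zero φ hlcv, h4]
  · have h := congrArg (Polynomial.map φ) hAB
    rw [Polynomial.map_add, Polynomial.map_mul, Polynomial.map_mul, ← Polynomial.derivative_map, map_C] at h
    refine ⟨C (φ N)⁻¹ * A.map φ, C (φ N)⁻¹ * B.map φ, ?_⟩
    rw [mul_assoc, mul_assoc, ← mul_add, h, ← C_mul, inv_mul_cancel₀ hNv, C_1]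

end BadPlaces

/-! ### C5: a fixed-point-free element when `12 ∣ #Gal(f/ℚ)` -/

section DoubleTransposition

variable {K : Type*} [Field K] [NumberField K] [IsCyclotomicExtension {3} ℚ K]

/-- **A Galois element moving every root.**  If `12 ∣ #Gal(f/ℚ)` then some `g ∈ Γ_K`, `K = ℚ(ω)`, fixes
no root of `f_K` in `K̄`: the image of `Γ_K` in `Sym(roots) ≅ S₄` contains `A₄`
(`alternatingGroup_le_range_toPermHom_rootSet_map`), hence a double transposition.
[cite: Zarhin2018SuperellipticJacobians, §8 (i) (arXiv p. 22)] -/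
theorem picard_exists_forall_smul_rootSet_ne (f : ℤ[X]) (h4 : f.natDegree = 4)
    (hsep : (f.map (Int.castRingHom ℚ)).Separable) (h12 : 12 ∣ Nat.card (f.map (Int.castRingHom ℚ)).Gal) :
    ∃ g : absoluteGaloisGroup K,
      ∀ x : (f.map (algebraMap ℤ K)).rootSet (AlgebraicClosure K), g • x ≠ x := by
  classical
  set X := (f.map (algebraMap ℤ K)).rootSet (AlgebraicClosure K) with hX
  have hcard : Fintype.card X = 4 := card_rootSet_map_algebraMap_int K h4 hsep
  set e : X ≃ Fin 4 := Fintype.equivFinOfCardEq hcard with he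
  set s0 : Equiv.Perm (Fin 4) := Equiv.swap 0 1 * Equiv.swap 2 3 with hs0
  have hs0fix : ∀ i : Fin 4, s0 i ≠ i := by decide
  have hs0sign : Equiv.Perm.sign s0 = 1 := by decide
  set s : Equiv.Perm X := e.symm.permCongr s0 with hs
  have hsA : s ∈ alternatingGroup X := by
    rw [Equiv.Perm.mem_alternatingGroup, hs, Equiv.Perm.sign_permCongr, hs0sign]
  obtain ⟨g, hg⟩ := alternatingGroup_le_range_toPermHom_rootSet_map f h4 hsep h12 hsA
  refine ⟨g, fun x hx => hs0fix (e x) ?_⟩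
  have h1 : s x = g • x := by
    rw [← hg, MulAction.toPermHom_apply, MulAction.toPerm_apply]
  have h2 : s x = e.symm (s0 (e x)) := by
    rw [hs, Equiv.permCongr_apply, Equiv.symm_symm]
  have h3 : e.symm (s0 (e x)) = x := by rw [← h2, h1, hx]
  simpa using congrArg e h3

end DoubleTransposition


/-! ### C6: permutation groups on four letters with all fixed-point counts `≡ 1 (mod 3)`; roots in `K` -/

section PermFour

/-- **Permutation groups on four letters whose elements all have `1` or `4` fixed points have a common
fixed point.**  If a group `G` acts on a `4`-element set `X` and every `g ∈ G` has a number of fixed points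
`≡ 1 (mod 3)`, then some `x ∈ X` is fixed by all of `G`: the image `H ≤ Sym(X)` has no element of order `2`
(an involution has an even number of fixed points, so `4`, so it is trivial), hence odd order dividing `24`,
so `#H ∈ {1, 3}` and `H` is cyclic; a generator has a fixed point, fixed by all its powers. [folklore] -/
theorem exists_forall_smul_eq_of_card_fixed_mod_three {G X : Type*} [Group G] [MulAction G X] [Fintype X]
    (hX : Fintype.card X = 4) (h : ∀ g : G, Nat.card {x : X // g • x = x} % 3 = 1) :
    ∃ x : X, ∀ g : G, g • x = x := by
  classical
  set H : Subgroup (Equiv.Perm X) := (MulAction.toPermHom G X).range with hHdef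
  -- (1) fixed points of the elements of `H`
  have hH : ∀ σ : H, ((σ : Equiv.Perm X).supportᶜ).card % 3 = 1 := by
    rintro ⟨_, g, rfl⟩
    have hg := h g
    rw [Nat.card_eq_fintype_card, Fintype.card_subtype] at hg
    have hs : ((MulAction.toPermHom G X g).supportᶜ : Finset X) =
        Finset.univ.filter (fun x : X => g • x = x) := by
      ext x
      simp [Equiv.Perm.mem_support]
    show ((MulAction.toPermHom G X g).supportᶜ).card % 3 = 1
    rw [hs]
    convert hg
  -- (2) `H` has odd order
  have hodd : ¬ 2 ∣ Nat.card H := by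
    intro h2
    haveI : Fact (Nat.Prime 2) := ⟨Nat.prime_two⟩
    obtain ⟨σ, hσ⟩ := exists_prime_orderOf_dvd_card' 2 h2
    have hσ2 : (σ : Equiv.Perm X) ^ 2 ^ 1 = 1 := by
      rw [pow_one, ← Subgroup.coe_pow, ← hσ, pow_orderOf_eq_one, Subgroup.coe_one]
    have hmod := Equiv.Perm.card_compl_support_modEq hσ2
    have h1 := hH σ
    have hle : ((σ : Equiv.Perm X).supportᶜ).card ≤ 4 := hX ▸ Finset.card_le_univ _
    rw [hX, Nat.ModEq] at hmod
    have h4 : ((σ : Equiv.Perm X).supportᶜ).card = 4 := by omega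
    rw [Finset.card_compl, hX] at h4
    have hσ1 : (σ : Equiv.Perm X) = 1 := by
      rw [← Equiv.Perm.support_eq_empty_iff, ← Finset.card_eq_zero]
      omega
    have ho : orderOf σ = 1 := by
      rw [orderOf_eq_one_iff]
      exact Subtype.ext hσ1
    rw [hσ] at ho
    exact absurd ho (by norm_num)
  -- (3) `#H ∣ 24`, so `#H ∈ {1, 3}` and `H` is cyclic
  have hdvd : Nat.card H ∣ 24 := by
    have hd := Subgroup.card_subgroup_dvd_card H
    rwa [Nat.card_eq_fintype_card (α := Equiv.Perm X), Fintype.card_perm, hX] at hd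
  have hcard : Nat.card H = 1 ∨ Nat.card H = 3 := by
    have hpos : 0 < Nat.card H := Nat.card_pos
    have hle : Nat.card H ≤ 24 := Nat.le_of_dvd (by norm_num) hdvd
    interval_cases hn : Nat.card H <;> omega
  have hcyc : IsCyclic H := by
    rcases hcard with h1 | h3
    · haveI : Subsingleton H := (Nat.card_eq_one_iff_unique.mp h1).1
      infer_instance
    · haveI : Fact (Nat.Prime 3) := ⟨Nat.prime_three⟩
      exact isCyclic_of_prime_card h3
  obtain ⟨σ₀, hσ₀⟩ := hcyc.exists_generator
  -- (4) a fixed point of the generator is fixed by everything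
  have hne : ((σ₀ : Equiv.Perm X).supportᶜ).Nonempty := by
    apply Finset.card_ne_zero.1
    have := hH σ₀
    omega
  obtain ⟨x, hx⟩ := hne
  rw [Finset.mem_compl, Equiv.Perm.notMem_support] at hx
  refine ⟨x, fun g => ?_⟩
  have hg : (⟨MulAction.toPermHom G X g, g, rfl⟩ : H) ∈ Subgroup.zpowers σ₀ := hσ₀ _
  obtain ⟨k, hk⟩ := Subgroup.mem_zpowers_iff.1 hg
  have hk' := congrArg (fun σ : H => (σ : Equiv.Perm X) x) hk
  simp only [Subgroup.coe_zpow, MulAction.toPermHom_apply, MulAction.toPerm_apply] at hk'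
  rw [← hk']
  exact Equiv.Perm.zpow_apply_eq_self_of_apply_eq_self hx k

end PermFour

section RootInK

variable (K : Type*) [Field K] [NumberField K]

/-- **If `f` has no root in `K`, some `g ∈ Γ_K` has a number of fixed roots `≢ 1 (mod 3)`** (i.e. `0` or `2`
of the four roots of `f` in `K̄`): otherwise all of `Γ_K` fixes a root (`exists_forall_smul_eq_of_card_fixed_mod_three`),
which then lies in `K` (`K̄^{Γ_K} = K`). [folklore] -/
theorem picard_exists_card_fixed_mod_three_ne_one (f : ℤ[X]) (h4 : f.natDegree = 4)
    (hsep : (f.map (Int.castRingHom ℚ)).Separable) (hroot : ∀ x : K, f.eval₂ (Int.castRingHom K) x ≠ 0) :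
    ∃ g : absoluteGaloisGroup K,
      Nat.card {α : (f.map (algebraMap ℤ K)).rootSet (AlgebraicClosure K) // g • α = α} % 3 ≠ 1 := by
  by_contra hall
  push Not at hall
  obtain ⟨x, hx⟩ := exists_forall_smul_eq_of_card_fixed_mod_three
    (card_rootSet_map_algebraMap_int K h4 hsep) hall
  -- `x` is fixed by `Γ_K`, hence lies in `K`
  have hxK : (x : AlgebraicClosure K) ∈ (⊥ : IntermediateField K (AlgebraicClosure K)) := by
    rw [InfiniteGalois.mem_bot_iff_fixed]
    intro σ
    have h := congrArg (fun y : (f.map (algebraMap ℤ K)).rootSet (AlgebraicClosure K) => (y : AlgebraicClosure K))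
      (hx ((absoluteGaloisGroup.toAlgEquiv K).symm σ))
    simpa only [rootSet.coe_smul, absoluteGaloisGroup.toAlgEquiv_symm_apply] using h
  obtain ⟨k, hk⟩ := IntermediateField.mem_bot.1 hxK
  apply hroot k
  have hxroot := (mem_rootSet.1 x.2).2
  rw [← hk, aeval_algebraMap_apply, map_eq_zero_iff _ (algebraMap K (AlgebraicClosure K)).injective,
    aeval_def, eval₂_map] at hxroot
  have hφ : (algebraMap K K).comp (algebraMap ℤ K) = Int.castRingHom K := RingHom.ext_int _ _
  rwa [hφ] at hxroot

end RootInK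

/-! ### C2: Chebotarev for the Frobenius permutation of the roots -/

section ChebotarevRoots

/-- A homomorphism of topological groups with open kernel is continuous. [folklore] -/
private theorem continuous_of_isOpen_ker_monoidHom {Γ M : Type*} [Group Γ] [TopologicalSpace Γ]
    [IsTopologicalGroup Γ] [Group M] [TopologicalSpace M] [IsTopologicalGroup M] (φ : Γ →* M)
    (hφ : IsOpen (φ.ker : Set Γ)) : Continuous φ := by
  refine continuous_of_continuousAt_one φ ?_
  rw [ContinuousAt, map_one]
  refine Filter.tendsto_def.mpr fun W hW => Filter.mem_of_superset (hφ.mem_nhds φ.ker.one_mem) ?_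
  intro x hx
  rw [Set.mem_preimage, (MonoidHom.mem_ker).mp hx]
  exact mem_of_mem_nhds hW

variable {K : Type} [Field K] [NumberField K]

/-- **Chebotarev for the Galois action on the roots of a polynomial** (existence form): for `p ∈ K[X]` and
`g ∈ Γ_K` there are infinitely many finite places `v` of `K` admitting an arithmetic Frobenius (at some prime
of `ℤ̄_K` above `v`) which permutes the roots of `p` in `K̄` exactly as `g` does.  This is the tree's PROVED
Chebotarev theorem (`chebotarev_cyclotomicExtension_holds`, `infinite_setOf_frobenius_eq_of_isCyclic`,
`FramedGaloisRep.infinite_setOf_frobenius_eq_of_cyclic`) applied to the permutation representation of `Γ_K`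
on `ℂ^{roots}` (open kernel `Gal(K̄/K(roots))`). [cite: NeukirchANT1999, VII Thm. (13.4)]
[cite: TateGCFT1967, §2.4 Tchebotarev density theorem] -/
theorem infinite_setOf_exists_isArithFrobAt_smul_rootSet_eq (p : K[X]) (g : absoluteGaloisGroup K) :
    {v : HeightOneSpectrum (𝓞 K) | ∃ 𝔓 ∈ v.primesAbove, ∃ Φ : absoluteGaloisGroup K,
      IsArithFrobAt (𝓞 K) Φ 𝔓 ∧ ∀ x : p.rootSet (AlgebraicClosure K), Φ • x = g • x}.Infinite := by
  classical
  set X := p.rootSet (AlgebraicClosure K) with hX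
  set n := Fintype.card X with hn
  set e : X ≃ Fin n := Fintype.equivFin X with he
  -- the permutation representation `Γ_K → Perm(roots) ≃ Perm(Fin n) → GL_n(ℂ)`
  set π : absoluteGaloisGroup K →* Equiv.Perm (Fin n) :=
    e.permCongrHom.toMonoidHom.comp (MulAction.toPermHom (absoluteGaloisGroup K) X) with hπ
  have hπapply : ∀ (γ : absoluteGaloisGroup K) (i : Fin n), π γ i = e (γ • e.symm i) := fun γ i => rfl
  set σ₀ : absoluteGaloisGroup K →* GL (Fin n) ℂ := ((Matrix.permMatrixHom (R := ℂ)).comp π).toHomUnits with hσ₀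
  have hσ₀apply : ∀ γ, ((σ₀ γ : GL (Fin n) ℂ) : Matrix (Fin n) (Fin n) ℂ) = (π γ)⁻¹.permMatrix ℂ := fun γ => rfl
  -- its kernel contains `Gal(K̄/K(roots))`, hence is open
  set E : IntermediateField K (AlgebraicClosure K) := IntermediateField.adjoin K (X : Set (AlgebraicClosure K)) with hE
  haveI : FiniteDimensional K E :=
    IntermediateField.finiteDimensional_adjoin fun x _ => Algebra.IsIntegral.isIntegral x
  have hker : ∀ γ : absoluteGaloisGroup K, absoluteGaloisGroup.toAlgEquiv K γ ∈ E.fixingSubgroup →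
      γ ∈ σ₀.ker := by
    intro γ hγ
    have hfix : ∀ x : X, γ • x = x := fun x => by
      apply Subtype.ext
      rw [rootSet.coe_smul, absoluteGaloisGroup.smul_def]
      exact (IntermediateField.mem_fixingSubgroup_iff _ _).1 hγ _
        (IntermediateField.subset_adjoin K _ x.2)
    have hπ1 : π γ = 1 := by
      refine Equiv.ext fun i => ?_
      rw [hπapply, hfix, Equiv.apply_symm_apply, Equiv.Perm.coe_one, id_eq]
    rw [MonoidHom.mem_ker]
    apply Units.ext
    rw [hσ₀apply, hπ1, inv_one, Matrix.permMatrix_one, Units.val_one]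
  have hopen : IsOpen (σ₀.ker : Set (absoluteGaloisGroup K)) := by
    refine Subgroup.isOpen_mono (H₁ := (E.fixingSubgroup).comap
      (absoluteGaloisGroup.toAlgEquiv K).toMonoidHom) ?_ ?_
    · intro τ hτ
      exact hker τ hτ
    · exact E.fixingSubgroup_isOpen
  set σ : FramedGaloisRep K ℂ n :=
    { toMonoidHom := σ₀, continuous_toFun := continuous_of_isOpen_ker_monoidHom σ₀ hopen } with hσ
  -- Chebotarev
  have hinf := FramedGaloisRep.infinite_setOf_frobenius_eq_of_cyclic
    (fun M L _ _ _ _ _ _ g' hg' => infinite_setOf_frobenius_eq_of_isCyclic chebotarev_cyclotomicExtension_holds g' hg')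
    σ hopen g
  refine hinf.mono ?_
  rintro v ⟨-, 𝔓, h𝔓, Φ, hΦ, hσΦ⟩
  refine ⟨𝔓, h𝔓, Φ, hΦ, fun x => ?_⟩
  -- from `σ Φ = σ g` to the actions on the roots
  have hmat : ((π Φ)⁻¹).permMatrix ℂ = ((π g)⁻¹).permMatrix ℂ := by
    rw [← hσ₀apply, ← hσ₀apply]
    exact congrArg (fun u : GL (Fin n) ℂ => (u : Matrix (Fin n) (Fin n) ℂ)) hσΦ
  have hperm : (π Φ)⁻¹ = (π g)⁻¹ := by
    have h := PEquiv.toMatrix_injective hmat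
    refine Equiv.ext fun i => ?_
    have hi := congrArg (fun q : Fin n ≃. Fin n => q i) h
    simpa [Equiv.toPEquiv_apply] using hi
  have hπeq : π Φ = π g := inv_injective hperm
  have h := congrArg (fun q : Equiv.Perm (Fin n) => e.symm (q (e x))) hπeq
  simp only [hπapply, Equiv.symm_apply_apply] at h
  exact h

end ChebotarevRoots

section PicardLocalFree

variable (K : Type) [Field K] [NumberField K] [IsCyclotomicExtension {3} ℚ K]
variable (f : ℤ[X]) [hf4 : Fact (f.natDegree = 4)] [hfs : Fact (f.map (Int.castRingHom ℚ)).Separable]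

attribute [local instance] fact_irreducible_picard_inst picardEisensteinModule picard_isScalarTower_inst
  picard_smulCommClass_inst

/-- (Local instance.) `J_f[1 - ω]` is finite (`27` elements). [cite: Schaefer1998, §3 Prop. 3.2] -/
theorem picard_finite_geomLambdaTorsion_inst : Finite (geomLambdaTorsion K 3 (f.map (algebraMap ℤ K))) :=
  Nat.finite_of_card_ne_zero (by rw [picard_card_geomLambdaTorsion K f hf4.out hfs.out]; norm_num)

/-- (Local instance.) `T₃ J(C_f)` is a finitely generated `ℤ₃`-module — no torsion count needed. [folklore] -/
theorem picard_finite_tateModule_inst : Module.Finite ℤ_[3] (TateModule (GeomPic K 3 (f.map (algebraMap ℤ K))) 3) :=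
  haveI := picard_finite_geomLambdaTorsion_inst K f
  finite_tateModule_of_finite_geomLambdaTorsion (isPrimitiveRoot_zeta3 K) (separable_map_algebraMap_int K hfs.out)
    (not_three_dvd_natDegree_map K hf4.out)

/-- (Local instance.) `T₃ J(C_f)` is a free `ℤ₃`-module — no torsion count needed. [folklore] -/
theorem picard_free_tateModule_inst : Module.Free ℤ_[3] (TateModule (GeomPic K 3 (f.map (algebraMap ℤ K))) 3) :=
  haveI := picard_finite_geomLambdaTorsion_inst K f
  free_tateModule_of_finite_geomLambdaTorsion (isPrimitiveRoot_zeta3 K) (separable_map_algebraMap_int K hfs.out)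
    (not_three_dvd_natDegree_map K hf4.out)

variable {K f}

variable
  (hX2 : ∀ (K : Type) [Field K] [NumberField K] (p : ℕ) [Fact p.Prime] (f : K[X]) (f₀ : (𝓞 K)[X]),
    f₀.map (algebraMap (𝓞 K) K) = f →
    ∀ (𝔭 : HeightOneSpectrum (𝓞 K)) (𝔓 : Ideal (absIntegers (𝓞 K) K)) [𝔓.IsMaximal] [𝔓.LiesOver 𝔭.asIdeal],
    (p : 𝓞 K) ∉ 𝔭.asIdeal → ¬ p ∣ f.natDegree →
    (f₀.map (Ideal.Quotient.mk 𝔭.asIdeal)).natDegree = f.natDegree →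
    (f₀.map (Ideal.Quotient.mk 𝔭.asIdeal)).Separable →
    ∀ [Fact (Irreducible (superellipticPoly K (AlgebraicClosure K) p f))]
      [Fact (Irreducible (superellipticPoly (𝓞 K ⧸ 𝔭.asIdeal) (absIntegers (𝓞 K) K ⧸ 𝔓) p
        (f₀.map (Ideal.Quotient.mk 𝔭.asIdeal))))],
    ∃ red : GeomPic K p f →+
        SuperellipticPic (𝓞 K ⧸ 𝔭.asIdeal) (absIntegers (𝓞 K) K ⧸ 𝔓) p (f₀.map (Ideal.Quotient.mk 𝔭.asIdeal)),
      (∀ (τ : MulAction.stabilizer (absoluteGaloisGroup K) 𝔓) (c : GeomPic K p f),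
          red ((τ : absoluteGaloisGroup K) • c) =
            (Ideal.Quotient.stabilizerHom 𝔓 𝔭.asIdeal (absoluteGaloisGroup K) τ) • red c) ∧
      (∀ (ζ : CyclicCoverDeck (AlgebraicClosure K) p) (c : GeomPic K p f),
          red (ζ • c) = CyclicCoverDeck.reduceMod K p 𝔓 ζ • red c) ∧
      (∀ N : ℕ, (N : 𝓞 K ⧸ 𝔭.asIdeal) ≠ 0 →
        (∀ c : GeomPic K p f, N • c = 0 → red c = 0 → c = 0) ∧
        (∀ c', N • c' = 0 → ∃ c : GeomPic K p f, N • c = 0 ∧ red c = c')))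
  (hX3 : ∀ (k : Type) [Field k] [Fintype k] (Ω : Type) [Field Ω] [Algebra k Ω] [IsAlgClosed Ω]
    [Algebra.IsAlgebraic k Ω] (p : ℕ) [Fact p.Prime] (ℓ : ℕ) [Fact ℓ.Prime] (f : k[X]),
    (p : k) ≠ 0 → (ℓ : k) ≠ 0 → f.Separable → ¬ p ∣ f.natDegree →
    ∀ [Fact (Irreducible (superellipticPoly k Ω p f))] (φ : Ω ≃ₐ[k] Ω), (∀ x : Ω, φ x = x ^ Fintype.card k) →
    ∀ (ξ : CyclicCoverDeck Ω p),
      LinearMap.trace ℚ_[ℓ] (RationalTateModule (SuperellipticPic k Ω p f) ℓ)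
        (rationalTateRepresentation (Ω ≃ₐ[k] Ω) (SuperellipticPic k Ω p f) ℓ φ ∘ₗ
          rationalTateRepresentation (CyclicCoverDeck Ω p) (SuperellipticPic k Ω p f) ℓ ξ) =
        (Fintype.card k : ℚ_[ℓ]) + 1 -
          Nat.card {P : PlaceOver Ω (SuperellipticFunctionField k Ω p f) // φ • (ξ • P) = P})


section GoodPrime

variable {𝔭 : HeightOneSpectrum (𝓞 K)} (h3𝔭 : (3 : 𝓞 K) ∉ 𝔭.asIdeal)
  (hdeg𝔭 : (f.map ((Ideal.Quotient.mk 𝔭.asIdeal).comp (algebraMap ℤ (𝓞 K)))).natDegree = 4)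
  (hsep𝔭 : (f.map ((Ideal.Quotient.mk 𝔭.asIdeal).comp (algebraMap ℤ (𝓞 K)))).Separable)
  {𝔓 : Ideal (absIntegers (𝓞 K) K)} [𝔓.IsMaximal] [h𝔓over : 𝔓.LiesOver 𝔭.asIdeal]

include hX2 hX3 h3𝔭 hdeg𝔭 hsep𝔭 in
set_option maxHeartbeats 800000 in
/-- **`tr_{ℤ₃}(τ δ^i | T₃ J(C_f))` at a Frobenius `τ` is the twisted point count** — the theorem
`picard_trace_frob_deck` of `PicardLambdaAdicRepLocal` (there from the torsion structure `hX1`;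
`picard_trace_frob_deck_of_card` from the count `hcard`) WITHOUT ANY TORSION INPUT: `T₃ J(C_f)` is free of
finite rank because `J[1 - ω]` is finite
(`free_tateModule_of_finite_geomLambdaTorsion`), and the reduction datum, bijective on `3`-power torsion,
induces an ISOMORPHISM of Tate modules (`tateModule_map_bijective_of_forall_torsionBy`), so the ranks of the two
fibres agree whatever they are; then transfer of traces (`trace_eq_of_injective_of_comp_eq`), the twisted
Lefschetz trace formula (`hX3`), fixed places of `Frob ∘ δ̄^i` (`card_fixedPlaces_frobenius_deck`) and
cubic character sums (`picard_twistedCount_eq_characterSum`), verbatim as in `picard_trace_frob_deck_of_card`.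
[cite: Upton2009, §2] [cite: Milne1986JacobianVarieties, §11 Prop. 11.2] -/
private theorem picard_trace_frob_deck_of_bij
    (τ : absoluteGaloisGroup K) (hτ : IsArithFrobAt (𝓞 K) τ 𝔓) {i : ℕ} (hi : i < 3) :
    ∃ m : ℤ,
      LinearMap.trace ℤ_[3] _
        (DistribSMul.toLinearMap ℤ_[3] (TateModule (GeomPic K 3 (f.map (algebraMap ℤ K))) 3) τ ∘ₗ
          DistribSMul.toLinearMap ℤ_[3] (TateModule (GeomPic K 3 (f.map (algebraMap ℤ K))) 3)
            (deckGen (isPrimitiveRoot_zeta3 K) ^ i)) = m ∧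
      (m : 𝓞 K) = (zeta3Int K ^ i) ^ 2 * picardTrace f 𝔭 + zeta3Int K ^ i * picardTrace (f ^ 2) 𝔭 := by
  classical
  haveI : Fact (Nat.Prime 3) := ⟨Nat.prime_three⟩
  haveI := fact_irreducible_reduction_inst (K := K) (f := f) hdeg𝔭 hsep𝔭 (𝔓 := 𝔓)
  letI : Fintype (𝓞 K ⧸ 𝔭.asIdeal) := Fintype.ofFinite (𝓞 K ⧸ 𝔭.asIdeal)
  haveI : IsAlgClosed (absIntegers (𝓞 K) K ⧸ 𝔓) := absIntegers.isAlgClosed_quotient 𝔓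
  haveI : Algebra.IsAlgebraic (𝓞 K ⧸ 𝔭.asIdeal) (absIntegers (𝓞 K) K ⧸ 𝔓) := inferInstance
  have hfb' : ((f.map (algebraMap ℤ (𝓞 K))).map (Ideal.Quotient.mk 𝔭.asIdeal)) = f.map ((Ideal.Quotient.mk 𝔭.asIdeal).comp (algebraMap ℤ (𝓞 K))) :=
    map_map_mk_ringOfIntegers K f 𝔭
  have h3k : (3 : (𝓞 K ⧸ 𝔭.asIdeal)) ≠ 0 := three_ne_zero_residue h3𝔭
  have hq : Fintype.card (𝓞 K ⧸ 𝔭.asIdeal) = 𝔭.residueCard := by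
    rw [HeightOneSpectrum.residueCard_eq_card_quotient, Nat.card_eq_fintype_card]
  have hdegb : ((f.map (algebraMap ℤ (𝓞 K))).map (Ideal.Quotient.mk 𝔭.asIdeal)).natDegree = 4 := by rw [hfb']; exact hdeg𝔭
  have hsepb : ((f.map (algebraMap ℤ (𝓞 K))).map (Ideal.Quotient.mk 𝔭.asIdeal)).Separable := by rw [hfb']; exact hsep𝔭
  have hndvdb : ¬ 3 ∣ ((f.map (algebraMap ℤ (𝓞 K))).map (Ideal.Quotient.mk 𝔭.asIdeal)).natDegree := by rw [hdegb]; decide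
  have hpq : 3 ∣ Fintype.card (𝓞 K ⧸ 𝔭.asIdeal) - 1 := by
    rw [hq]; exact three_dvd_residueCard_sub_one (isPrimitiveRoot_zeta3Int K) h3𝔭
  -- the reduction datum and ranks (special fibre count from the bijection, not from `hX1`)
  obtain ⟨red, hredτ, hredζ, hinj, hsurj⟩ := picard_exists_reduction_bij (K := K) (f := f) hX2 h3𝔭 hdeg𝔭 hsep𝔭 (𝔓 := 𝔓)
  haveI : Module.Finite ℤ_[3] (TateModule (GeomPic K 3 (f.map (algebraMap ℤ K))) 3) := picard_finite_tateModule_inst K f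
  haveI : Module.Free ℤ_[3] (TateModule (GeomPic K 3 (f.map (algebraMap ℤ K))) 3) := picard_free_tateModule_inst K f
  have hbij := tateModule_map_bijective_of_forall_torsionBy red hinj hsurj
  set ered := LinearEquiv.ofBijective (TateModule.map 3 red) hbij with hered
  haveI : Module.Finite ℤ_[3] (TateModule (SuperellipticPic (𝓞 K ⧸ 𝔭.asIdeal) (absIntegers (𝓞 K) K ⧸ 𝔓) 3
      ((f.map (algebraMap ℤ (𝓞 K))).map (Ideal.Quotient.mk 𝔭.asIdeal))) 3) := Module.Finite.equiv ered
  haveI : Module.Free ℤ_[3] (TateModule (SuperellipticPic (𝓞 K ⧸ 𝔭.asIdeal) (absIntegers (𝓞 K) K ⧸ 𝔓) 3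
      ((f.map (algebraMap ℤ (𝓞 K))).map (Ideal.Quotient.mk 𝔭.asIdeal))) 3) := Module.Free.of_equiv ered
  have hrank : Module.finrank ℤ_[3] (TateModule (GeomPic K 3 (f.map (algebraMap ℤ K))) 3) =
      Module.finrank ℤ_[3] (TateModule (SuperellipticPic (𝓞 K ⧸ 𝔭.asIdeal) (absIntegers (𝓞 K) K ⧸ 𝔓) 3 ((f.map (algebraMap ℤ (𝓞 K))).map (Ideal.Quotient.mk 𝔭.asIdeal))) 3) :=
    ered.finrank_eq
  -- the Frobenius automorphism of `κ(𝔓)` and the reduced deck transformation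
  set φ : (absIntegers (𝓞 K) K ⧸ 𝔓) ≃ₐ[(𝓞 K ⧸ 𝔭.asIdeal)] (absIntegers (𝓞 K) K ⧸ 𝔓) :=
    Ideal.Quotient.stabilizerHom 𝔓 𝔭.asIdeal (absoluteGaloisGroup K) ⟨τ, hτ.mem_stabilizer⟩ with hφdef
  have hφ : ∀ x : (absIntegers (𝓞 K) K ⧸ 𝔓), φ x = x ^ Fintype.card (𝓞 K ⧸ 𝔭.asIdeal) := stabilizerHom_apply_eq_pow (K := K) τ hτ
  set ξ : CyclicCoverDeck (absIntegers (𝓞 K) K ⧸ 𝔓) 3 := CyclicCoverDeck.reduceMod K 3 𝔓 (deckGen (isPrimitiveRoot_zeta3 K) ^ i) with hξdef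
  -- transfer of the trace to the special fibre
  have htransfer : LinearMap.trace ℤ_[3] _
      (DistribSMul.toLinearMap ℤ_[3] (TateModule (GeomPic K 3 (f.map (algebraMap ℤ K))) 3) τ ∘ₗ
        DistribSMul.toLinearMap ℤ_[3] (TateModule (GeomPic K 3 (f.map (algebraMap ℤ K))) 3)
          (deckGen (isPrimitiveRoot_zeta3 K) ^ i)) =
      LinearMap.trace ℤ_[3] _
        (DistribSMul.toLinearMap ℤ_[3] (TateModule (SuperellipticPic (𝓞 K ⧸ 𝔭.asIdeal) (absIntegers (𝓞 K) K ⧸ 𝔓) 3 ((f.map (algebraMap ℤ (𝓞 K))).map (Ideal.Quotient.mk 𝔭.asIdeal))) 3) φ ∘ₗ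
          DistribSMul.toLinearMap ℤ_[3] (TateModule (SuperellipticPic (𝓞 K ⧸ 𝔭.asIdeal) (absIntegers (𝓞 K) K ⧸ 𝔓) 3 ((f.map (algebraMap ℤ (𝓞 K))).map (Ideal.Quotient.mk 𝔭.asIdeal))) 3) ξ) :=
    trace_eq_of_injective_of_comp_eq hrank (TateModule.map 3 red) hbij.1 _ _
      (TateModule.map_comp_toLinearMap_eq red τ φ (fun c => hredτ ⟨τ, hτ.mem_stabilizer⟩ c) _ ξ
        (fun c => hredζ _ c))
  -- twisted Lefschetz on `V₃` of the special fibre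
  have hlef := hX3 (𝓞 K ⧸ 𝔭.asIdeal) (absIntegers (𝓞 K) K ⧸ 𝔓) 3 3 ((f.map (algebraMap ℤ (𝓞 K))).map (Ideal.Quotient.mk 𝔭.asIdeal)) (by exact_mod_cast h3k) (by exact_mod_cast h3k) hsepb hndvdb φ hφ ξ
  rw [trace_rationalTateRepresentation_comp] at hlef
  -- the fixed places of `Frob ∘ δ̄^i`
  have hfix := SuperellipticFunctionField.card_fixedPlaces_frobenius_deck (k := (𝓞 K ⧸ 𝔭.asIdeal)) (Ω := (absIntegers (𝓞 K) K ⧸ 𝔓)) (p := 3) (f := ((f.map (algebraMap ℤ (𝓞 K))).map (Ideal.Quotient.mk 𝔭.asIdeal))) φ hφ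
    (by exact_mod_cast h3k) hsepb hndvdb hpq ξ
  -- the label condition in the two spellings
  have hξval : ξ.val = algebraMap (𝓞 K ⧸ 𝔭.asIdeal) (absIntegers (𝓞 K) K ⧸ 𝔓) (Ideal.Quotient.mk 𝔭.asIdeal (zeta3Int K ^ i)) :=
    val_reduceMod_deckGen_pow (K := K) (𝔓 := 𝔓) i
  have hfilter : (Finset.univ.filter fun a : (𝓞 K ⧸ 𝔭.asIdeal) => ((f.map (algebraMap ℤ (𝓞 K))).map (Ideal.Quotient.mk 𝔭.asIdeal)).eval a ≠ 0 ∧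
      algebraMap (𝓞 K ⧸ 𝔭.asIdeal) (absIntegers (𝓞 K) K ⧸ 𝔓) (((f.map (algebraMap ℤ (𝓞 K))).map (Ideal.Quotient.mk 𝔭.asIdeal)).eval a) ^ ((Fintype.card (𝓞 K ⧸ 𝔭.asIdeal) - 1) / 3) = ξ.val) =
      (Finset.univ.filter fun a : (𝓞 K ⧸ 𝔭.asIdeal) =>
        (f.map ((Ideal.Quotient.mk 𝔭.asIdeal).comp (algebraMap ℤ (𝓞 K)))).eval a ≠ 0 ∧
          Ideal.Quotient.mk 𝔭.asIdeal (zeta3Int K ^ i) =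
            (f.map ((Ideal.Quotient.mk 𝔭.asIdeal).comp (algebraMap ℤ (𝓞 K)))).eval a ^ ((𝔭.residueCard - 1) / 3)) := by
    refine Finset.filter_congr fun a _ => ?_
    rw [hfb', hξval, ← map_pow, hq]
    exact and_congr_right fun _ => ⟨fun h => ((algebraMap (𝓞 K ⧸ 𝔭.asIdeal) (absIntegers (𝓞 K) K ⧸ 𝔓)).injective h).symm,
      fun h => congrArg (algebraMap (𝓞 K ⧸ 𝔭.asIdeal) (absIntegers (𝓞 K) K ⧸ 𝔓)) h.symm⟩
  have hfilter0 : (Finset.univ.filter fun a : (𝓞 K ⧸ 𝔭.asIdeal) => ((f.map (algebraMap ℤ (𝓞 K))).map (Ideal.Quotient.mk 𝔭.asIdeal)).eval a = 0) =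
      (Finset.univ.filter fun a : (𝓞 K ⧸ 𝔭.asIdeal) =>
        (f.map ((Ideal.Quotient.mk 𝔭.asIdeal).comp (algebraMap ℤ (𝓞 K)))).eval a = 0) := by
    rw [hfb']
  -- the character sum
  have hchar := picard_twistedCount_eq_characterSum (isPrimitiveRoot_zeta3Int K) h3𝔭 f hi
  -- assemble
  refine ⟨(Fintype.card (𝓞 K ⧸ 𝔭.asIdeal) : ℤ) + 1 -
    (Nat.card {P : PlaceOver (absIntegers (𝓞 K) K ⧸ 𝔓) (SuperellipticFunctionField (𝓞 K ⧸ 𝔭.asIdeal) (absIntegers (𝓞 K) K ⧸ 𝔓) 3 ((f.map (algebraMap ℤ (𝓞 K))).map (Ideal.Quotient.mk 𝔭.asIdeal))) // φ • (ξ • P) = P} : ℕ), ?_, ?_⟩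
  · apply IsFractionRing.injective ℤ_[3] ℚ_[3]
    rw [htransfer, hlef]
    simp only [map_sub, map_add, map_natCast, map_one, Int.cast_sub, Int.cast_add, Int.cast_natCast,
      Int.cast_one]
  · rw [hfix, hfilter, hfilter0, ← hchar]
    push_cast
    ring


include hX2 hX3 h3𝔭 hdeg𝔭 hsep𝔭 in
/-- **`tr_{ℤ₃}(τ | T₃ J(C_f)) ≡ 2 (#roots of f̄ in k_𝔭) - 2 (mod 3)`** at an arithmetic Frobenius `τ` of a good
prime `𝔭 ∤ 3`: the trace is the integer `m₀` with `m₀ = a_𝔭(f) + a_𝔭(f²)` (`picard_trace_frob_deck_of_bij`,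
`i = 0`), and each cubic character sum is `≡ #{x : f̄ x = 0} - 1 (mod 1 - ζ)` (`χ ≡ 1` off the roots,
`neg_sum_cubicResidueSymbol_eval_sub_mem_span`), while `(1 - ζ) ∩ ℤ = 3ℤ`. [cite: Upton2009, §2]
[cite: IrelandRosen1982, Ch. 9 §3] -/
theorem picard_trace_frob_congr [DecidableEq (𝓞 K ⧸ 𝔭.asIdeal)] (τ : absoluteGaloisGroup K) (hτ : IsArithFrobAt (𝓞 K) τ 𝔓) :
    ∃ m : ℤ,
      LinearMap.trace ℤ_[3] _ (DistribSMul.toLinearMap ℤ_[3] (TateModule (GeomPic K 3 (f.map (algebraMap ℤ K))) 3) τ) = m ∧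
      (3 : ℤ) ∣ m + 2 - 2 * ((f.map ((Ideal.Quotient.mk 𝔭.asIdeal).comp (algebraMap ℤ (𝓞 K)))).roots.toFinset.card : ℤ) := by
  classical
  letI : Fintype (𝓞 K ⧸ 𝔭.asIdeal) := Fintype.ofFinite (𝓞 K ⧸ 𝔭.asIdeal)
  obtain ⟨m, hm, hm'⟩ := picard_trace_frob_deck_of_bij (K := K) (f := f) hX2 hX3 h3𝔭 hdeg𝔭 hsep𝔭 (𝔓 := 𝔓) τ hτ
    (i := 0) (by norm_num)
  refine ⟨m, ?_, ?_⟩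
  · have h1 : DistribSMul.toLinearMap ℤ_[3] (TateModule (GeomPic K 3 (f.map (algebraMap ℤ K))) 3)
        (1 : CyclicCoverDeck (AlgebraicClosure K) 3) = LinearMap.id :=
      LinearMap.ext fun x => one_smul _ x
    rw [pow_zero, h1, LinearMap.comp_id] at hm
    exact hm
  · set g : (𝓞 K ⧸ 𝔭.asIdeal)[X] := f.map ((Ideal.Quotient.mk 𝔭.asIdeal).comp (algebraMap ℤ (𝓞 K))) with hg
    have hg0 : g ≠ 0 := by
      intro h0
      rw [h0, natDegree_zero] at hdeg𝔭
      exact absurd hdeg𝔭 (by norm_num)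
    have hg20 : g ^ 2 ≠ 0 := pow_ne_zero 2 hg0
    have hζ := isPrimitiveRoot_zeta3Int K
    -- the two character-sum congruences
    have hA := neg_sum_cubicResidueSymbol_eval_sub_mem_span hζ h3𝔭 hg0
    have hA' := neg_sum_cubicResidueSymbol_eval_sub_mem_span hζ h3𝔭 hg20
    have hroots : (g ^ 2).roots.toFinset = g.roots.toFinset := by
      rw [roots_pow, Multiset.toFinset_nsmul _ _ two_ne_zero]
    rw [hroots] at hA'
    have hT : picardTrace f 𝔭 = -∑ x, cubicResidueSymbol 𝔭 (g.eval x) := picardTrace_eq_neg_sum f 𝔭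
    have hT' : picardTrace (f ^ 2) 𝔭 = -∑ x, cubicResidueSymbol 𝔭 ((g ^ 2).eval x) := by
      rw [picardTrace_eq_neg_sum, Polynomial.map_pow]
    rw [pow_zero, one_pow, one_mul, one_mul, hT, hT'] at hm'
    have hsum : (m : 𝓞 K) - 2 * ((g.roots.toFinset.card : 𝓞 K) - 1) ∈ Ideal.span {1 - zeta3Int K} := by
      have h := Ideal.add_mem _ hA hA'
      rw [hm']
      convert h using 1
      ring
    refine three_dvd_of_intCast_mem_span_one_sub hζ ?_
    push_cast
    convert hsum using 1
    ring

/-- **At a Frobenius fixing `J[1 - ω]` pointwise, `tr_{ℤ₃}(τ | T₃ J(C_f)) ≡ rank (mod 3)`**: `τ - 1` maps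
`T` into `λT` (`ker θ = λT`), hence `(τ - 1)²` maps `T` into `λ²T = 3T`; so `τ - 1` is nilpotent on `T/3T` and has
trace `≡ 0 (mod 3)`. [cite: SerreAbelianLadic1968, Ch. I §1.1] -/
theorem picard_three_dvd_trace_sub_finrank (τ : absoluteGaloisGroup K)
    (hτJ : ∀ y ∈ geomLambdaTorsion K 3 (f.map (algebraMap ℤ K)), τ • y = y) {m : ℤ}
    (hm : LinearMap.trace ℤ_[3] _ (DistribSMul.toLinearMap ℤ_[3] (TateModule (GeomPic K 3 (f.map (algebraMap ℤ K))) 3) τ) = m) :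
    (3 : ℤ) ∣ m - Module.finrank ℤ_[3] (TateModule (GeomPic K 3 (f.map (algebraMap ℤ K))) 3) := by
  classical
  haveI : Module.Finite ℤ_[3] (TateModule (GeomPic K 3 (f.map (algebraMap ℤ K))) 3) := picard_finite_tateModule_inst K f
  haveI : Module.Free ℤ_[3] (TateModule (GeomPic K 3 (f.map (algebraMap ℤ K))) 3) := picard_free_tateModule_inst K f
  have hζ := isPrimitiveRoot_zeta3 K
  have hsep' := separable_map_algebraMap_int K hfs.out
  have hndvd := not_three_dvd_natDegree_map K hf4.out
  set T := TateModule (GeomPic K 3 (f.map (algebraMap ℤ K))) 3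
  -- (1) `τ t - t ∈ λT`
  have hlam : ∀ t : T, ∃ s : T, PadicEisenstein.lam • s = τ • t - t := fun t => by
    apply exists_lam_smul_eq_of_comp_proj_eq_zero hζ hsep' hndvd
    rw [map_sub, comp_proj_smul hζ, hτJ _ (comp_proj_mem_geomLambdaTorsion hζ hsep' hndvd t), sub_self]
  -- (2) `N = τ - 1` has `N² T ⊆ 3T`
  set N : T →ₗ[ℤ_[3]] T := DistribSMul.toLinearMap ℤ_[3] T τ - LinearMap.id with hN
  have hNapply : ∀ t, N t = τ • t - t := fun t => rfl
  have hNN : ∀ t : T, ∃ w : T, (3 : ℤ_[3]) • w = N (N t) := fun t => by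
    obtain ⟨s, hs⟩ := hlam t
    obtain ⟨s', hs'⟩ := hlam s
    refine ⟨-PadicEisenstein.omega • s', ?_⟩
    rw [exists_three_smul_eq_lam_lam_smul hζ hsep' hndvd, hs', hNapply, hNapply, ← hs,
      absoluteGaloisGroup_smul_padicEisenstein_smul hζ hsep' hndvd, ← smul_sub]
  -- (3) the matrix of `N` modulo `3` squares to zero, so its trace vanishes
  set b := Module.finBasis ℤ_[3] T with hb
  set M : Matrix _ _ ℤ_[3] := LinearMap.toMatrix b b N with hM
  have h30 : PadicInt.toZMod (3 : ℤ_[3]) = 0 := by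
    rw [show (3 : ℤ_[3]) = ((3 : ℕ) : ℤ_[3]) by norm_num, map_natCast]
    exact ZMod.natCast_self 3
  have hMM : ∀ i j, PadicInt.toZMod ((M * M) i j) = 0 := fun i j => by
    rw [hM, ← LinearMap.toMatrix_mul, LinearMap.toMatrix_apply, Module.End.mul_apply]
    obtain ⟨w, hw⟩ := hNN (b j)
    rw [← hw, map_smul, Finsupp.smul_apply, smul_eq_mul, map_mul, h30, zero_mul]
  set Mb : Matrix _ _ (ZMod 3) := M.map PadicInt.toZMod with hMb
  have hsq : Mb * Mb = 0 := by
    rw [hMb, ← Matrix.map_mul]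
    ext i j
    rw [Matrix.map_apply, hMM]
    rfl
  have hnil : IsNilpotent Mb := ⟨2, by rw [pow_two, hsq]⟩
  have htr0 : Mb.trace = 0 := (Matrix.isNilpotent_trace_of_isNilpotent hnil).eq_zero
  have htr : Mb.trace = PadicInt.toZMod M.trace := by
    simp only [Matrix.trace, Matrix.diag_apply, hMb, Matrix.map_apply, map_sum]
  -- (4) `tr N = m - rank`
  have hN' : LinearMap.trace ℤ_[3] T N = (m : ℤ_[3]) - Module.finrank ℤ_[3] T := by
    rw [hN, map_sub, hm, LinearMap.trace_id]
  have hcast : PadicInt.toZMod (((m - (Module.finrank ℤ_[3] T : ℤ) : ℤ) : ℤ_[3])) = 0 := by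
    rw [Int.cast_sub, Int.cast_natCast, ← hN', LinearMap.trace_eq_matrix_trace ℤ_[3] b, ← hM, ← htr, htr0]
  rw [map_intCast] at hcast
  exact (ZMod.intCast_zmod_eq_zero_iff_dvd _ 3).1 hcast

/-- The trace of an endomorphism of a free module of rank `0` vanishes. [folklore] -/
theorem trace_eq_zero_of_finrank_eq_zero {R M : Type*} [CommRing R] [Nontrivial R] [AddCommGroup M] [Module R M]
    [Module.Free R M] [Module.Finite R M] (h : Module.finrank R M = 0) (φ : M →ₗ[R] M) :
    LinearMap.trace R M φ = 0 := by
  classical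
  haveI : IsEmpty (Fin (Module.finrank R M)) := by
    rw [h]
    infer_instance
  rw [LinearMap.trace_eq_matrix_trace R (Module.finBasis R M), Matrix.trace, Finset.univ_eq_empty, Finset.sum_empty]

end GoodPrime

/-! ### Assembly I: good Chebotarev places, the rank dichotomy, rank `6` for generic `f` -/

omit [IsCyclotomicExtension {3} ℚ K] in
/-- **Good Chebotarev places.**  For every `g ∈ Γ_K` there is a finite place `𝔭 ∤ 3` of `K` at which
`f mod 𝔭` is still a separable quartic, a prime `𝔓 ∣ 𝔭` of `ℤ̄_K` and an arithmetic Frobenius `Φ` at `𝔓`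
permuting the roots of `f` in `K̄` exactly as `g` does: Chebotarev
(`infinite_setOf_exists_isArithFrobAt_smul_rootSet_eq`) minus the finitely many bad places
(`picard_setOf_badPlace_finite`). [cite: NeukirchANT1999, VII Thm. (13.4)] -/
theorem picard_exists_goodPlace_frob_smul_rootSet_eq (g : absoluteGaloisGroup K) :
    ∃ (𝔭 : HeightOneSpectrum (𝓞 K)) (𝔓 : Ideal (absIntegers (𝓞 K) K)) (Φ : absoluteGaloisGroup K),
      (3 : 𝓞 K) ∉ 𝔭.asIdeal ∧
      (f.map ((Ideal.Quotient.mk 𝔭.asIdeal).comp (algebraMap ℤ (𝓞 K)))).natDegree = 4 ∧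
      (f.map ((Ideal.Quotient.mk 𝔭.asIdeal).comp (algebraMap ℤ (𝓞 K)))).Separable ∧
      𝔓 ∈ 𝔭.primesAbove ∧ IsArithFrobAt (𝓞 K) Φ 𝔓 ∧
      ∀ x : (f.map (algebraMap ℤ K)).rootSet (AlgebraicClosure K), Φ • x = g • x := by
  have hinf := infinite_setOf_exists_isArithFrobAt_smul_rootSet_eq (f.map (algebraMap ℤ K)) g
  have hfin := picard_setOf_badPlace_finite (K := K) f hf4.out hfs.out
  obtain ⟨v, hv, hgood⟩ := (hinf.sdiff hfin).nonempty
  rw [Set.mem_setOf_eq, not_not] at hgood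
  obtain ⟨𝔓, h𝔓, Φ, hΦ, hsmul⟩ := hv
  exact ⟨v, 𝔓, Φ, hgood.1, hgood.2.1, hgood.2.2, h𝔓, hΦ, hsmul⟩

/-- **`#J_f[3ⁿ] = 3^{6n}` from rank `6`**: `#J_f[1 - ω] = 27 = 3³` (`picard_card_geomLambdaTorsion`) and
`rank_{ℤ₃} T₃ J(C_f) = 6 = 2 · 3` give the torsion count by the `λ`-dévissage
(`card_torsionBy_pow_eq_of_finrank_eq`). [cite: SerreAbelianLadic1968, Ch. I §1.1] -/
theorem picard_hcard_of_finrank_eq_six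
    (h6 : Module.finrank ℤ_[3] (TateModule (GeomPic K 3 (f.map (algebraMap ℤ K))) 3) = 6) (n : ℕ) :
    Nat.card (AddSubgroup.torsionBy (GeomPic K 3 (f.map (algebraMap ℤ K))) (3 ^ n : ℕ)) = 3 ^ (2 * 3 * n) :=
  haveI := picard_finite_geomLambdaTorsion_inst K f
  card_torsionBy_pow_eq_of_finrank_eq (isPrimitiveRoot_zeta3 K) (separable_map_algebraMap_int K hfs.out)
    (not_three_dvd_natDegree_map K hf4.out) (r := 3)
    (by rw [picard_card_geomLambdaTorsion K f hf4.out hfs.out]) (by rw [h6]) n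

/-- A free module of finite rank `0` is trivial. [folklore] -/
theorem subsingleton_of_finrank_eq_zero {R M : Type*} [CommRing R] [Nontrivial R] [AddCommGroup M] [Module R M]
    [Module.Free R M] [Module.Finite R M] (h : Module.finrank R M = 0) : Subsingleton M := by
  haveI : IsEmpty (Fin (Module.finrank R M)) := by
    rw [h]
    infer_instance
  exact (Module.finBasis R M).repr.toEquiv.subsingleton

include hX2 hX3 in
/-- **A Galois element moving every root forces `T₃ J(C_f) ≠ 0`.**  If some `g ∈ Γ_K` fixes no root of
`f` in `K̄`, take (Chebotarev) a good place `𝔭 ∤ 3` with a Frobenius `Φ` permuting the roots like `g`; then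
`f mod 𝔭` has no root in `k_𝔭` (`roots_toFinset_card_eq_zero_of_forall_smul_ne`), so
`tr(Φ | T) ≡ 2 · 0 - 2 ≢ 0 (mod 3)` (`picard_trace_frob_congr`), and `T ≠ 0`.
[cite: Upton2009, §2] [cite: NeukirchANT1999, VII Thm. (13.4)] -/
theorem picard_finrank_tateModule_ne_zero_of_forall_smul_ne {g : absoluteGaloisGroup K}
    (hg : ∀ x : (f.map (algebraMap ℤ K)).rootSet (AlgebraicClosure K), g • x ≠ x) :
    Module.finrank ℤ_[3] (TateModule (GeomPic K 3 (f.map (algebraMap ℤ K))) 3) ≠ 0 := by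
  classical
  obtain ⟨𝔭, 𝔓, Φ, h3𝔭, hdeg𝔭, hsep𝔭, h𝔓, hΦ, hsmul⟩ :=
    picard_exists_goodPlace_frob_smul_rootSet_eq (K := K) (f := f) g
  haveI := HeightOneSpectrum.isMaximal_of_mem_primesAbove h𝔓
  haveI : 𝔓.LiesOver 𝔭.asIdeal := h𝔓.2
  obtain ⟨m, hm, hdvd⟩ := picard_trace_frob_congr (K := K) (f := f) hX2 hX3 h3𝔭 hdeg𝔭 hsep𝔭 (𝔓 := 𝔓) Φ hΦ
  have hmove : ∀ x : (f.map (algebraMap ℤ K)).rootSet (AlgebraicClosure K), Φ • x ≠ x := fun x => by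
    rw [hsmul]
    exact hg x
  rw [roots_toFinset_card_eq_zero_of_forall_smul_ne f hf4.out hfs.out hdeg𝔭 hsep𝔭 h𝔓 hΦ hmove] at hdvd
  intro h0
  haveI := picard_finite_tateModule_inst K f
  haveI := picard_free_tateModule_inst K f
  have htr := trace_eq_zero_of_finrank_eq_zero h0
    (DistribSMul.toLinearMap ℤ_[3] (TateModule (GeomPic K 3 (f.map (algebraMap ℤ K))) 3) Φ)
  rw [hm, Int.cast_eq_zero] at htr
  subst htr
  norm_num at hdvd

include hX2 hX3 in
/-- **The rank dichotomy: `rank_{ℤ₃} T₃ J(C_f) ∈ {0, 6}`** (given the good-reduction datum and the twisted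
Lefschetz formula, WITHOUT any torsion count or divisibility input).  Write `s = rank T = 2r` with
`[T : λT] = 3^r ≤ #J[1 - ω] = 27` (`exists_finrank_eq_two_mul`), so `r ≤ 3`.  Take (Chebotarev, `g = 1`) a good
place `𝔭 ∤ 3` whose Frobenius `Φ` fixes every root of `f`: then `f mod 𝔭` has `4` roots in `k_𝔭`, so
`tr(Φ | T) = m ≡ 2 · 4 - 2 ≡ 0 (mod 3)` (`picard_trace_frob_congr`); and `Φ` is trivial on
`J[1 - ω] ≅ (𝔽₃^{roots})⁰` (`picard_smul_geomLambdaTorsion_eq_of_forall_smul_rootSet_eq`), so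
`m ≡ s (mod 3)` (`picard_three_dvd_trace_sub_finrank`).  Hence `3 ∣ r`, `r ∈ {0, 3}`.
[cite: Upton2009, §2] [cite: SerreAbelianLadic1968, Ch. I §1.1] [cite: NeukirchANT1999, VII Thm. (13.4)] -/
theorem picard_finrank_tateModule_eq_zero_or_eq_six :
    Module.finrank ℤ_[3] (TateModule (GeomPic K 3 (f.map (algebraMap ℤ K))) 3) = 0 ∨
      Module.finrank ℤ_[3] (TateModule (GeomPic K 3 (f.map (algebraMap ℤ K))) 3) = 6 := by
  classical
  haveI := picard_finite_geomLambdaTorsion_inst K f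
  have hζ := isPrimitiveRoot_zeta3 K
  have hsep' := separable_map_algebraMap_int K hfs.out
  have hndvd := not_three_dvd_natDegree_map K hf4.out
  obtain ⟨r, hr, -, hle⟩ := exists_finrank_eq_two_mul hζ hsep' hndvd
  rw [picard_card_geomLambdaTorsion K f hf4.out hfs.out] at hle
  have hr3 : r ≤ 3 := by
    by_contra h
    have h4r : 3 ^ 4 ≤ 3 ^ r := Nat.pow_le_pow_right (by norm_num) (by omega)
    exact absurd (le_trans h4r hle) (by norm_num)
  obtain ⟨𝔭, 𝔓, Φ, h3𝔭, hdeg𝔭, hsep𝔭, h𝔓, hΦ, hsmul⟩ :=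
    picard_exists_goodPlace_frob_smul_rootSet_eq (K := K) (f := f) 1
  haveI := HeightOneSpectrum.isMaximal_of_mem_primesAbove h𝔓
  haveI : 𝔓.LiesOver 𝔭.asIdeal := h𝔓.2
  have hfix : ∀ x : (f.map (algebraMap ℤ K)).rootSet (AlgebraicClosure K), Φ • x = x := fun x => by
    rw [hsmul, one_smul]
  obtain ⟨m, hm, hdvd⟩ := picard_trace_frob_congr (K := K) (f := f) hX2 hX3 h3𝔭 hdeg𝔭 hsep𝔭 (𝔓 := 𝔓) Φ hΦ
  rw [roots_toFinset_card_eq_four_of_forall_smul_eq f hf4.out hfs.out hdeg𝔭 hsep𝔭 h𝔓 hΦ hfix] at hdvd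
  have hdvd' := picard_three_dvd_trace_sub_finrank (K := K) (f := f) Φ
    (picard_smul_geomLambdaTorsion_eq_of_forall_smul_rootSet_eq K f hf4.out hfs.out Φ hfix) hm
  rw [hr] at hdvd' ⊢
  push_cast at hdvd hdvd'
  omega

include hX2 hX3 in
/-- **Rank `6` for generic `f`**: if some `g ∈ Γ_K` fixes no root of `f` then `rank_{ℤ₃} T₃ J(C_f) = 6`
(the dichotomy, and `T ≠ 0`). [cite: Upton2009, §2] -/
theorem picard_finrank_tateModule_eq_six_of_forall_smul_ne {g : absoluteGaloisGroup K}
    (hg : ∀ x : (f.map (algebraMap ℤ K)).rootSet (AlgebraicClosure K), g • x ≠ x) :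
    Module.finrank ℤ_[3] (TateModule (GeomPic K 3 (f.map (algebraMap ℤ K))) 3) = 6 :=
  (picard_finrank_tateModule_eq_zero_or_eq_six (K := K) (f := f) hX2 hX3).resolve_left
    (picard_finrank_tateModule_ne_zero_of_forall_smul_ne (K := K) (f := f) hX2 hX3 hg)

include hX2 hX3 in
/-- **Rank `6` from `T ≠ 0`** (the dichotomy). [cite: Upton2009, §2] -/
theorem picard_finrank_tateModule_eq_six_of_nontrivial
    [Nontrivial (TateModule (GeomPic K 3 (f.map (algebraMap ℤ K))) 3)] :
    Module.finrank ℤ_[3] (TateModule (GeomPic K 3 (f.map (algebraMap ℤ K))) 3) = 6 := by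
  refine (picard_finrank_tateModule_eq_zero_or_eq_six (K := K) (f := f) hX2 hX3).resolve_left fun h0 => ?_
  haveI := picard_finite_tateModule_inst K f
  haveI := picard_free_tateModule_inst K f
  haveI := subsingleton_of_finrank_eq_zero h0
  exact false_of_nontrivial_of_subsingleton (TateModule (GeomPic K 3 (f.map (algebraMap ℤ K))) 3)

include hX2 hX3 in
/-- **A Galois element with `#(fixed roots) ≢ 1 (mod 3)` forces `T₃ J(C_f) ≠ 0`** (the general form of
`picard_finrank_tateModule_ne_zero_of_forall_smul_ne`): at a good Chebotarev place whose Frobenius `Φ` permutes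
the roots like `g`, `#{x ∈ k_𝔭 : f̄(x) = 0} = #Fix(Φ) = #Fix(g)` (`roots_toFinset_card_eq_card_fixed`), and
`tr(Φ | T) ≡ 2 #Fix(g) - 2 ≢ 0 (mod 3)`. [cite: Upton2009, §2] [cite: NeukirchANT1999, VII Thm. (13.4)] -/
theorem picard_finrank_tateModule_ne_zero_of_card_fixed_mod_three_ne_one {g : absoluteGaloisGroup K}
    (hg : Nat.card {α : (f.map (algebraMap ℤ K)).rootSet (AlgebraicClosure K) // g • α = α} % 3 ≠ 1) :
    Module.finrank ℤ_[3] (TateModule (GeomPic K 3 (f.map (algebraMap ℤ K))) 3) ≠ 0 := by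
  classical
  obtain ⟨𝔭, 𝔓, Φ, h3𝔭, hdeg𝔭, hsep𝔭, h𝔓, hΦ, hsmul⟩ :=
    picard_exists_goodPlace_frob_smul_rootSet_eq (K := K) (f := f) g
  haveI := HeightOneSpectrum.isMaximal_of_mem_primesAbove h𝔓
  haveI : 𝔓.LiesOver 𝔭.asIdeal := h𝔓.2
  obtain ⟨m, hm, hdvd⟩ := picard_trace_frob_congr (K := K) (f := f) hX2 hX3 h3𝔭 hdeg𝔭 hsep𝔭 (𝔓 := 𝔓) Φ hΦ
  rw [roots_toFinset_card_eq_card_fixed f hf4.out hfs.out hdeg𝔭 hsep𝔭 h𝔓 hΦ] at hdvd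
  have hfix : Nat.card {α : (f.map (algebraMap ℤ K)).rootSet (AlgebraicClosure K) // Φ • α = α} =
      Nat.card {α : (f.map (algebraMap ℤ K)).rootSet (AlgebraicClosure K) // g • α = α} := by
    simp only [hsmul]
  rw [hfix] at hdvd
  intro h0
  haveI := picard_finite_tateModule_inst K f
  haveI := picard_free_tateModule_inst K f
  have htr := trace_eq_zero_of_finrank_eq_zero h0
    (DistribSMul.toLinearMap ℤ_[3] (TateModule (GeomPic K 3 (f.map (algebraMap ℤ K))) 3) Φ)
  rw [hm, Int.cast_eq_zero] at htr
  subst htr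
  omega

include hX2 hX3 in
/-- **Rank `6` from a Galois element with `#(fixed roots) ≢ 1 (mod 3)`** (the dichotomy, and `T ≠ 0`).
[cite: Upton2009, §2] -/
theorem picard_finrank_tateModule_eq_six_of_card_fixed_mod_three_ne_one {g : absoluteGaloisGroup K}
    (hg : Nat.card {α : (f.map (algebraMap ℤ K)).rootSet (AlgebraicClosure K) // g • α = α} % 3 ≠ 1) :
    Module.finrank ℤ_[3] (TateModule (GeomPic K 3 (f.map (algebraMap ℤ K))) 3) = 6 :=
  (picard_finrank_tateModule_eq_zero_or_eq_six (K := K) (f := f) hX2 hX3).resolve_left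
    (picard_finrank_tateModule_ne_zero_of_card_fixed_mod_three_ne_one (K := K) (f := f) hX2 hX3 hg)

include hX2 hX3 in
/-- **Rank `6` when `f` has no root in `K`** (`picard_exists_card_fixed_mod_three_ne_one`). [cite: Upton2009, §2] -/
theorem picard_finrank_tateModule_eq_six_of_forall_eval₂_ne_zero
    (hroot : ∀ x : K, f.eval₂ (Int.castRingHom K) x ≠ 0) :
    Module.finrank ℤ_[3] (TateModule (GeomPic K 3 (f.map (algebraMap ℤ K))) 3) = 6 := by
  obtain ⟨g, hg⟩ := picard_exists_card_fixed_mod_three_ne_one K f hf4.out hfs.out hroot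
  exact picard_finrank_tateModule_eq_six_of_card_fixed_mod_three_ne_one (K := K) (f := f) hX2 hX3 hg

include hX2 hX3 in
/-- `picard_finrank_tateModule_eq_six_of_card_fixed_mod_three_ne_one` with the roots of `f` taken via
`Int.castRingHom K` (no `ℤ`-algebra structure on `K` in the statement, for use with `K = CyclotomicField 3 ℚ`).
[cite: Upton2009, §2] -/
theorem picard_finrank_tateModule_eq_six_of_card_fixed_mod_three_ne_one' {g : absoluteGaloisGroup K}
    (hg : Nat.card {α : (f.map (Int.castRingHom K)).rootSet (AlgebraicClosure K) // g • α = α} % 3 ≠ 1) :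
    Module.finrank ℤ_[3] (TateModule (GeomPic K 3 (f.map (algebraMap ℤ K))) 3) = 6 := by
  have hmap : f.map (Int.castRingHom K) = f.map (algebraMap ℤ K) :=
    congrArg (fun φ : ℤ →+* K => f.map φ) (RingHom.ext_int _ _)
  rw [hmap] at hg
  exact picard_finrank_tateModule_eq_six_of_card_fixed_mod_three_ne_one (K := K) (f := f) hX2 hX3 hg

/-! ### Assembly II: the representation `ρ = ρ₁^∨` for one `f` of rank `6` -/

include hX2 hX3 in
/-- **The `λ`-adic representation of one Picard curve of rank `6`.**  For `f` with
`rank_{ℤ₃} T₃ J(C_f) = 6` (so `#J_f[3ⁿ] = 3^{6n}`, `picard_hcard_of_finrank_eq_six`) and an embedding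
`j : K → ℚ̄₃`, the dual `ρ = ρ₁^∨` of the representation `ρ₁` on `T ⊗_{ℤ₃[ω], j} ℤ̄₃` in the basis of
`picard_exists_basis_repr_smul_congr` is unramified at the good places `𝔭 ∤ 3`, has
`tr ρ(Frob_𝔭⁻¹) = j(a_𝔭(f))` there, and is absolutely irreducible when `12 ∣ #Gal(f/ℚ)` — the three clauses of
`picardCurve_exists_lambdaAdicRep` for this `f` (same assembly as
`picardCurve_exists_lambdaAdicRep_of_card_goodReduction_lefschetz`). [cite: Upton2009, Thm. 2.1 and §4] -/
theorem picard_exists_framedGaloisRep_of_finrank_eq_six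
    (h6 : Module.finrank ℤ_[3] (TateModule (GeomPic K 3 (f.map (algebraMap ℤ K))) 3) = 6)
    (j : K →+* PadicAlgCl 3) :
    ∃ ρ : FramedGaloisRep K (PadicAlgCl 3) 3,
      (∀ 𝔭 : HeightOneSpectrum (𝓞 K), (3 : 𝓞 K) ∉ 𝔭.asIdeal →
        (f.map ((Ideal.Quotient.mk 𝔭.asIdeal).comp (algebraMap ℤ (𝓞 K)))).natDegree = 4 →
        (f.map ((Ideal.Quotient.mk 𝔭.asIdeal).comp (algebraMap ℤ (𝓞 K)))).Separable →
          ρ.IsUnramifiedAt 𝔭 ∧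
          ∀ 𝔓 ∈ 𝔭.primesAbove, ∀ τ : absoluteGaloisGroup K, IsArithFrobAt (𝓞 K) τ 𝔓 →
            FramedRep.trace ρ τ⁻¹ = j (picardTrace f 𝔭 : K)) ∧
      (12 ∣ Nat.card (f.map (Int.castRingHom ℚ)).Gal → FramedRep.IsAbsolutelyIrreducible ρ) := by
  classical
  have hcard := picard_hcard_of_finrank_eq_six (K := K) (f := f) h6
  obtain ⟨r₀, b, hb⟩ := picard_exists_basis_repr_smul_congr K f hf4.out hfs.out (isPrimitiveRoot_zeta3 K) hcard
  have hR4 : Fintype.card ((f.map (algebraMap ℤ K)).rootSet (AlgebraicClosure K)) = 4 :=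
    card_rootSet_map_algebraMap_int K hf4.out hfs.out
  have hι : Fintype.card {y : (f.map (algebraMap ℤ K)).rootSet (AlgebraicClosure K) // y ≠ r₀} = 3 := by
    rw [Fintype.card_subtype_compl, hR4, Fintype.card_subtype_eq]
  set e := Fintype.equivFinOfCardEq hι with he
  -- `u = j(ω)²`, the other primitive cube root of unity of `ℚ̄₃`
  have hv : j (zeta3 K) ^ 2 + j (zeta3 K) + 1 = 0 := by
    set v := j (zeta3 K) with hvdef
    have hv3 : v ^ 3 = 1 := by
      rw [hvdef, ← map_pow, (isPrimitiveRoot_zeta3 K).pow_eq_one, map_one]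
    have hv1 : v ≠ 1 := by
      rw [hvdef, Ne, ← map_one j, j.injective.eq_iff]
      exact (isPrimitiveRoot_zeta3 K).ne_one (by norm_num)
    have h : (v - 1) * (v ^ 2 + v + 1) = 0 := by linear_combination hv3
    rcases mul_eq_zero.1 h with h | h
    · exact absurd (sub_eq_zero.1 h) hv1
    · exact h
  have hu : (j (zeta3 K) ^ 2) ^ 2 + j (zeta3 K) ^ 2 + 1 = 0 := sq_sq_add_sq_add_one hv
  refine ⟨FramedRep.dual (picardRho1 hcard (b.reindex e) (j (zeta3 K) ^ 2) hu), ?_, ?_⟩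
  · intro 𝔭 h3 hdeg𝔭 hsep𝔭
    refine ⟨(FramedGaloisRep.isUnramifiedAt_dual_iff 𝔭 _).2
      (picardRho1_isUnramifiedAt (K := K) (f := f) hX2 h3 hdeg𝔭 hsep𝔭 hcard _ _ hu), ?_⟩
    intro 𝔓 h𝔓 τ hτ
    exact trace_dual_picardRho1_frob_inv_of_card (K := K) (f := f) hX2 hX3 hcard _ j hu h3 hdeg𝔭 hsep𝔭 h𝔓 τ hτ
  · intro h12
    exact (picardRho1_isAbsolutelyIrreducible (K := K) (f := f) hcard h12 e b hb _ hu).dual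


end PicardLocalFree

/-! ### The theorems over `K = ℚ(ω)` -/

attribute [local instance] fact_irreducible_picard_inst picardEisensteinModule picard_isScalarTower_inst
  picard_smulCommClass_inst

/-- **Galois representations attached to generic Picard curves, from good reduction and Lefschetz alone.**
GIVEN (`hX2`) the good-reduction datum for `y^p = f(x)` at the primes `𝔭 ∤ p` where `f mod 𝔭` stays
separable of the same degree (Serre–Tate §1 Lemma 2 / Thm. 1; Deuring) and (`hX3`) the twisted Lefschetz
trace formula (Milne JV §11 Prop. 11.2 with `α = π ∘ ξ`): for every integer quartic `f`, separable over `ℚ`,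
with `12 ∣ #Gal(f/ℚ)` and every embedding `j : ℚ(ω) → ℚ̄₃` there is a continuous
`ρ : Γ_{ℚ(ω)} → GL₃(ℚ̄₃)`, unramified at the places `𝔭 ∤ 3` where `f mod 𝔭` is a separable quartic, with
`tr ρ(Frob_𝔭⁻¹) = j(a_𝔭(f))` there, and absolutely irreducible — ALL clauses of
`picardCurve_exists_lambdaAdicRep` for such `f`, with NO torsion-structure / divisibility / Weil input: the
rank `6` of `T₃ J(C_f)` is forced by Chebotarev (`picard_finrank_tateModule_eq_six_of_forall_smul_ne`:
`A₄ ⊆ im Γ_K` contains a double transposition, `picard_exists_forall_smul_rootSet_ne`).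
[cite: Upton2009, Thm. 2.1 and §4] [cite: SerreTate1968GoodReduction, §1, Thm. 1]
[cite: Milne1986JacobianVarieties, §11 Prop. 11.2] [cite: NeukirchANT1999, VII Thm. (13.4)] -/
theorem picardCurve_lambdaAdicRep_of_goodReduction_lefschetz_of_twelve_dvd
    (hX2 : ∀ (K : Type) [Field K] [NumberField K] (p : ℕ) [Fact p.Prime] (f : K[X]) (f₀ : (𝓞 K)[X]),
      f₀.map (algebraMap (𝓞 K) K) = f →
      ∀ (𝔭 : HeightOneSpectrum (𝓞 K)) (𝔓 : Ideal (absIntegers (𝓞 K) K)) [𝔓.IsMaximal] [𝔓.LiesOver 𝔭.asIdeal],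
      (p : 𝓞 K) ∉ 𝔭.asIdeal → ¬ p ∣ f.natDegree →
      (f₀.map (Ideal.Quotient.mk 𝔭.asIdeal)).natDegree = f.natDegree →
      (f₀.map (Ideal.Quotient.mk 𝔭.asIdeal)).Separable →
      ∀ [Fact (Irreducible (superellipticPoly K (AlgebraicClosure K) p f))]
        [Fact (Irreducible (superellipticPoly (𝓞 K ⧸ 𝔭.asIdeal) (absIntegers (𝓞 K) K ⧸ 𝔓) p
          (f₀.map (Ideal.Quotient.mk 𝔭.asIdeal))))],
      ∃ red : GeomPic K p f →+
          SuperellipticPic (𝓞 K ⧸ 𝔭.asIdeal) (absIntegers (𝓞 K) K ⧸ 𝔓) p (f₀.map (Ideal.Quotient.mk 𝔭.asIdeal)),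
        (∀ (τ : MulAction.stabilizer (absoluteGaloisGroup K) 𝔓) (c : GeomPic K p f),
            red ((τ : absoluteGaloisGroup K) • c) =
              (Ideal.Quotient.stabilizerHom 𝔓 𝔭.asIdeal (absoluteGaloisGroup K) τ) • red c) ∧
        (∀ (ζ : CyclicCoverDeck (AlgebraicClosure K) p) (c : GeomPic K p f),
            red (ζ • c) = CyclicCoverDeck.reduceMod K p 𝔓 ζ • red c) ∧
        (∀ N : ℕ, (N : 𝓞 K ⧸ 𝔭.asIdeal) ≠ 0 →
          (∀ c : GeomPic K p f, N • c = 0 → red c = 0 → c = 0) ∧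
          (∀ c', N • c' = 0 → ∃ c : GeomPic K p f, N • c = 0 ∧ red c = c')))
    (hX3 : ∀ (k : Type) [Field k] [Fintype k] (Ω : Type) [Field Ω] [Algebra k Ω] [IsAlgClosed Ω]
      [Algebra.IsAlgebraic k Ω] (p : ℕ) [Fact p.Prime] (ℓ : ℕ) [Fact ℓ.Prime] (f : k[X]),
      (p : k) ≠ 0 → (ℓ : k) ≠ 0 → f.Separable → ¬ p ∣ f.natDegree →
      ∀ [Fact (Irreducible (superellipticPoly k Ω p f))] (φ : Ω ≃ₐ[k] Ω), (∀ x : Ω, φ x = x ^ Fintype.card k) →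
      ∀ (ξ : CyclicCoverDeck Ω p),
        LinearMap.trace ℚ_[ℓ] (RationalTateModule (SuperellipticPic k Ω p f) ℓ)
          (rationalTateRepresentation (Ω ≃ₐ[k] Ω) (SuperellipticPic k Ω p f) ℓ φ ∘ₗ
            rationalTateRepresentation (CyclicCoverDeck Ω p) (SuperellipticPic k Ω p f) ℓ ξ) =
          (Fintype.card k : ℚ_[ℓ]) + 1 -
            Nat.card {P : PlaceOver Ω (SuperellipticFunctionField k Ω p f) // φ • (ξ • P) = P})
    (f : ℤ[X]) (h4 : f.natDegree = 4) (hsep : (f.map (Int.castRingHom ℚ)).Separable)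
    (h12 : 12 ∣ Nat.card (f.map (Int.castRingHom ℚ)).Gal) (j : CyclotomicField 3 ℚ →+* PadicAlgCl 3) :
    ∃ ρ : FramedGaloisRep (CyclotomicField 3 ℚ) (PadicAlgCl 3) 3,
      (∀ 𝔭 : HeightOneSpectrum (𝓞 (CyclotomicField 3 ℚ)),
          (3 : 𝓞 (CyclotomicField 3 ℚ)) ∉ 𝔭.asIdeal →
          (f.map ((Ideal.Quotient.mk 𝔭.asIdeal).comp
            (algebraMap ℤ (𝓞 (CyclotomicField 3 ℚ))))).natDegree = 4 →
          (f.map ((Ideal.Quotient.mk 𝔭.asIdeal).comp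
            (algebraMap ℤ (𝓞 (CyclotomicField 3 ℚ))))).Separable →
            ρ.IsUnramifiedAt 𝔭 ∧
            ∀ 𝔓 ∈ 𝔭.primesAbove, ∀ τ : absoluteGaloisGroup (CyclotomicField 3 ℚ),
              IsArithFrobAt (𝓞 (CyclotomicField 3 ℚ)) τ 𝔓 →
                FramedRep.trace ρ τ⁻¹ = j (picardTrace f 𝔭)) ∧
      FramedRep.IsAbsolutelyIrreducible ρ := by
  classical
  haveI : IsCyclotomicExtension {3} ℚ (CyclotomicField 3 ℚ) := CyclotomicField.isCyclotomicExtension 3 ℚ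
  haveI hf4 : Fact (f.natDegree = 4) := ⟨h4⟩
  haveI hfs : Fact (f.map (Int.castRingHom ℚ)).Separable := ⟨hsep⟩
  obtain ⟨g, hg⟩ := picard_exists_forall_smul_rootSet_ne (K := CyclotomicField 3 ℚ) f h4 hsep h12
  obtain ⟨ρ, h1, h2⟩ := picard_exists_framedGaloisRep_of_finrank_eq_six (K := CyclotomicField 3 ℚ) (f := f)
    hX2 hX3 (picard_finrank_tateModule_eq_six_of_forall_smul_ne (K := CyclotomicField 3 ℚ) (f := f) hX2 hX3 hg) j
  exact ⟨ρ, h1, h2 h12⟩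

/-- **Galois representations attached to Picard curves `y³ = f(x)` with `f` having NO ROOT in `ℚ(ω)`, from
good reduction and Lefschetz alone.**  GIVEN (`hX2`) the good-reduction datum and (`hX3`) the twisted Lefschetz
trace formula: for every integer quartic `f`, separable over `ℚ`, without roots in `ℚ(ω)`, and every embedding
`j : ℚ(ω) → ℚ̄₃`, there is a continuous `ρ : Γ_{ℚ(ω)} → GL₃(ℚ̄₃)` unramified at the places `𝔭 ∤ 3` where
`f mod 𝔭` is a separable quartic, with `tr ρ(Frob_𝔭⁻¹) = j(a_𝔭(f))` there, and absolutely irreducible when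
`12 ∣ #Gal(f/ℚ)` — every clause of `picardCurve_exists_lambdaAdicRep` for such `f`, with NO torsion / divisibility /
Weil input: if `f` has no root in `ℚ(ω)` some `g ∈ Γ_{ℚ(ω)}` fixes `0` or `2` roots
(`picard_exists_card_fixed_mod_three_ne_one`: a permutation group on `4` letters all of whose elements fix `1` or
`4` letters is `1` or `C₃`), and a good Chebotarev prime with that Frobenius has `tr ≢ 0 (mod 3)`, forcing rank
`6` (`picard_finrank_tateModule_eq_six_of_card_fixed_mod_three_ne_one`).  The complementary case — `f` with a
root in `ℚ(ω)` — is exactly where `picardCurve_exists_lambdaAdicRep_of_nontrivial_goodReduction_lefschetz` needs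
its input `hX0`. [cite: Upton2009, Thm. 2.1 and §4] [cite: SerreTate1968GoodReduction, §1, Thm. 1]
[cite: Milne1986JacobianVarieties, §11 Prop. 11.2] [cite: NeukirchANT1999, VII Thm. (13.4)] -/
theorem picardCurve_lambdaAdicRep_of_goodReduction_lefschetz_of_no_root
    (hX2 : ∀ (K : Type) [Field K] [NumberField K] (p : ℕ) [Fact p.Prime] (f : K[X]) (f₀ : (𝓞 K)[X]),
      f₀.map (algebraMap (𝓞 K) K) = f →
      ∀ (𝔭 : HeightOneSpectrum (𝓞 K)) (𝔓 : Ideal (absIntegers (𝓞 K) K)) [𝔓.IsMaximal] [𝔓.LiesOver 𝔭.asIdeal],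
      (p : 𝓞 K) ∉ 𝔭.asIdeal → ¬ p ∣ f.natDegree →
      (f₀.map (Ideal.Quotient.mk 𝔭.asIdeal)).natDegree = f.natDegree →
      (f₀.map (Ideal.Quotient.mk 𝔭.asIdeal)).Separable →
      ∀ [Fact (Irreducible (superellipticPoly K (AlgebraicClosure K) p f))]
        [Fact (Irreducible (superellipticPoly (𝓞 K ⧸ 𝔭.asIdeal) (absIntegers (𝓞 K) K ⧸ 𝔓) p
          (f₀.map (Ideal.Quotient.mk 𝔭.asIdeal))))],
      ∃ red : GeomPic K p f →+
          SuperellipticPic (𝓞 K ⧸ 𝔭.asIdeal) (absIntegers (𝓞 K) K ⧸ 𝔓) p (f₀.map (Ideal.Quotient.mk 𝔭.asIdeal)),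
        (∀ (τ : MulAction.stabilizer (absoluteGaloisGroup K) 𝔓) (c : GeomPic K p f),
            red ((τ : absoluteGaloisGroup K) • c) =
              (Ideal.Quotient.stabilizerHom 𝔓 𝔭.asIdeal (absoluteGaloisGroup K) τ) • red c) ∧
        (∀ (ζ : CyclicCoverDeck (AlgebraicClosure K) p) (c : GeomPic K p f),
            red (ζ • c) = CyclicCoverDeck.reduceMod K p 𝔓 ζ • red c) ∧
        (∀ N : ℕ, (N : 𝓞 K ⧸ 𝔭.asIdeal) ≠ 0 →
          (∀ c : GeomPic K p f, N • c = 0 → red c = 0 → c = 0) ∧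
          (∀ c', N • c' = 0 → ∃ c : GeomPic K p f, N • c = 0 ∧ red c = c')))
    (hX3 : ∀ (k : Type) [Field k] [Fintype k] (Ω : Type) [Field Ω] [Algebra k Ω] [IsAlgClosed Ω]
      [Algebra.IsAlgebraic k Ω] (p : ℕ) [Fact p.Prime] (ℓ : ℕ) [Fact ℓ.Prime] (f : k[X]),
      (p : k) ≠ 0 → (ℓ : k) ≠ 0 → f.Separable → ¬ p ∣ f.natDegree →
      ∀ [Fact (Irreducible (superellipticPoly k Ω p f))] (φ : Ω ≃ₐ[k] Ω), (∀ x : Ω, φ x = x ^ Fintype.card k) →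
      ∀ (ξ : CyclicCoverDeck Ω p),
        LinearMap.trace ℚ_[ℓ] (RationalTateModule (SuperellipticPic k Ω p f) ℓ)
          (rationalTateRepresentation (Ω ≃ₐ[k] Ω) (SuperellipticPic k Ω p f) ℓ φ ∘ₗ
            rationalTateRepresentation (CyclicCoverDeck Ω p) (SuperellipticPic k Ω p f) ℓ ξ) =
          (Fintype.card k : ℚ_[ℓ]) + 1 -
            Nat.card {P : PlaceOver Ω (SuperellipticFunctionField k Ω p f) // φ • (ξ • P) = P})
    (f : ℤ[X]) (h4 : f.natDegree = 4) (hsep : (f.map (Int.castRingHom ℚ)).Separable)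
    (hroot : ∀ x : CyclotomicField 3 ℚ, f.eval₂ (Int.castRingHom (CyclotomicField 3 ℚ)) x ≠ 0)
    (j : CyclotomicField 3 ℚ →+* PadicAlgCl 3) :
    ∃ ρ : FramedGaloisRep (CyclotomicField 3 ℚ) (PadicAlgCl 3) 3,
      (∀ 𝔭 : HeightOneSpectrum (𝓞 (CyclotomicField 3 ℚ)),
          (3 : 𝓞 (CyclotomicField 3 ℚ)) ∉ 𝔭.asIdeal →
          (f.map ((Ideal.Quotient.mk 𝔭.asIdeal).comp
            (algebraMap ℤ (𝓞 (CyclotomicField 3 ℚ))))).natDegree = 4 →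
          (f.map ((Ideal.Quotient.mk 𝔭.asIdeal).comp
            (algebraMap ℤ (𝓞 (CyclotomicField 3 ℚ))))).Separable →
            ρ.IsUnramifiedAt 𝔭 ∧
            ∀ 𝔓 ∈ 𝔭.primesAbove, ∀ τ : absoluteGaloisGroup (CyclotomicField 3 ℚ),
              IsArithFrobAt (𝓞 (CyclotomicField 3 ℚ)) τ 𝔓 →
                FramedRep.trace ρ τ⁻¹ = j (picardTrace f 𝔭)) ∧
      (12 ∣ Nat.card (f.map (Int.castRingHom ℚ)).Gal → FramedRep.IsAbsolutelyIrreducible ρ) := by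
  classical
  haveI : IsCyclotomicExtension {3} ℚ (CyclotomicField 3 ℚ) := CyclotomicField.isCyclotomicExtension 3 ℚ
  haveI hf4 : Fact (f.natDegree = 4) := ⟨h4⟩
  haveI hfs : Fact (f.map (Int.castRingHom ℚ)).Separable := ⟨hsep⟩
  exact picard_exists_framedGaloisRep_of_finrank_eq_six (K := CyclotomicField 3 ℚ) (f := f) hX2 hX3
    (picard_finrank_tateModule_eq_six_of_forall_eval₂_ne_zero (K := CyclotomicField 3 ℚ) (f := f) hX2 hX3 hroot) j

/-- **Galois representations attached to Picard curves, sharp generic form.**  GIVEN (`hX2`) the good-reduction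
datum and (`hX3`) the twisted Lefschetz trace formula: for every integer quartic `f`, separable over `ℚ`, for
which SOME `g ∈ Γ_{ℚ(ω)}` fixes a number of roots `≢ 1 (mod 3)` (i.e. `0` or `2` of the four roots of `f` in
`ℚ(ω)^alg` — equivalently, the image of `Γ_{ℚ(ω)}` on the roots is neither trivial nor a `C₃` fixing a root),
and every `j : ℚ(ω) → ℚ̄₃`, all clauses of `picardCurve_exists_lambdaAdicRep` hold for `f`, with no torsion /
divisibility / Weil input (`picard_finrank_tateModule_eq_six_of_card_fixed_mod_three_ne_one`).  The cases
`12 ∣ #Gal(f/ℚ)` (`…_of_twelve_dvd`) and "no root in `ℚ(ω)`" (`…_of_no_root`) are instances; the excluded `f`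
(totally split over `ℚ(ω)`, or linear × cubic with cyclic Galois group over `ℚ(ω)`) are exactly those for which
every Frobenius has `#roots(f mod 𝔭) ∈ {1, 4}` and the trace congruences are blind.
[cite: Upton2009, Thm. 2.1 and §4] [cite: SerreTate1968GoodReduction, §1, Thm. 1]
[cite: Milne1986JacobianVarieties, §11 Prop. 11.2] [cite: NeukirchANT1999, VII Thm. (13.4)] -/
theorem picardCurve_lambdaAdicRep_of_goodReduction_lefschetz_of_card_fixed
    (hX2 : ∀ (K : Type) [Field K] [NumberField K] (p : ℕ) [Fact p.Prime] (f : K[X]) (f₀ : (𝓞 K)[X]),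
      f₀.map (algebraMap (𝓞 K) K) = f →
      ∀ (𝔭 : HeightOneSpectrum (𝓞 K)) (𝔓 : Ideal (absIntegers (𝓞 K) K)) [𝔓.IsMaximal] [𝔓.LiesOver 𝔭.asIdeal],
      (p : 𝓞 K) ∉ 𝔭.asIdeal → ¬ p ∣ f.natDegree →
      (f₀.map (Ideal.Quotient.mk 𝔭.asIdeal)).natDegree = f.natDegree →
      (f₀.map (Ideal.Quotient.mk 𝔭.asIdeal)).Separable →
      ∀ [Fact (Irreducible (superellipticPoly K (AlgebraicClosure K) p f))]
        [Fact (Irreducible (superellipticPoly (𝓞 K ⧸ 𝔭.asIdeal) (absIntegers (𝓞 K) K ⧸ 𝔓) p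
          (f₀.map (Ideal.Quotient.mk 𝔭.asIdeal))))],
      ∃ red : GeomPic K p f →+
          SuperellipticPic (𝓞 K ⧸ 𝔭.asIdeal) (absIntegers (𝓞 K) K ⧸ 𝔓) p (f₀.map (Ideal.Quotient.mk 𝔭.asIdeal)),
        (∀ (τ : MulAction.stabilizer (absoluteGaloisGroup K) 𝔓) (c : GeomPic K p f),
            red ((τ : absoluteGaloisGroup K) • c) =
              (Ideal.Quotient.stabilizerHom 𝔓 𝔭.asIdeal (absoluteGaloisGroup K) τ) • red c) ∧
        (∀ (ζ : CyclicCoverDeck (AlgebraicClosure K) p) (c : GeomPic K p f),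
            red (ζ • c) = CyclicCoverDeck.reduceMod K p 𝔓 ζ • red c) ∧
        (∀ N : ℕ, (N : 𝓞 K ⧸ 𝔭.asIdeal) ≠ 0 →
          (∀ c : GeomPic K p f, N • c = 0 → red c = 0 → c = 0) ∧
          (∀ c', N • c' = 0 → ∃ c : GeomPic K p f, N • c = 0 ∧ red c = c')))
    (hX3 : ∀ (k : Type) [Field k] [Fintype k] (Ω : Type) [Field Ω] [Algebra k Ω] [IsAlgClosed Ω]
      [Algebra.IsAlgebraic k Ω] (p : ℕ) [Fact p.Prime] (ℓ : ℕ) [Fact ℓ.Prime] (f : k[X]),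
      (p : k) ≠ 0 → (ℓ : k) ≠ 0 → f.Separable → ¬ p ∣ f.natDegree →
      ∀ [Fact (Irreducible (superellipticPoly k Ω p f))] (φ : Ω ≃ₐ[k] Ω), (∀ x : Ω, φ x = x ^ Fintype.card k) →
      ∀ (ξ : CyclicCoverDeck Ω p),
        LinearMap.trace ℚ_[ℓ] (RationalTateModule (SuperellipticPic k Ω p f) ℓ)
          (rationalTateRepresentation (Ω ≃ₐ[k] Ω) (SuperellipticPic k Ω p f) ℓ φ ∘ₗ
            rationalTateRepresentation (CyclicCoverDeck Ω p) (SuperellipticPic k Ω p f) ℓ ξ) =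
          (Fintype.card k : ℚ_[ℓ]) + 1 -
            Nat.card {P : PlaceOver Ω (SuperellipticFunctionField k Ω p f) // φ • (ξ • P) = P})
    (f : ℤ[X]) (h4 : f.natDegree = 4) (hsep : (f.map (Int.castRingHom ℚ)).Separable)
    (hg : ∃ g : absoluteGaloisGroup (CyclotomicField 3 ℚ),
      Nat.card {α : (f.map (Int.castRingHom (CyclotomicField 3 ℚ))).rootSet
        (AlgebraicClosure (CyclotomicField 3 ℚ)) // g • α = α} % 3 ≠ 1)
    (j : CyclotomicField 3 ℚ →+* PadicAlgCl 3) :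
    ∃ ρ : FramedGaloisRep (CyclotomicField 3 ℚ) (PadicAlgCl 3) 3,
      (∀ 𝔭 : HeightOneSpectrum (𝓞 (CyclotomicField 3 ℚ)),
          (3 : 𝓞 (CyclotomicField 3 ℚ)) ∉ 𝔭.asIdeal →
          (f.map ((Ideal.Quotient.mk 𝔭.asIdeal).comp
            (algebraMap ℤ (𝓞 (CyclotomicField 3 ℚ))))).natDegree = 4 →
          (f.map ((Ideal.Quotient.mk 𝔭.asIdeal).comp
            (algebraMap ℤ (𝓞 (CyclotomicField 3 ℚ))))).Separable →
            ρ.IsUnramifiedAt 𝔭 ∧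
            ∀ 𝔓 ∈ 𝔭.primesAbove, ∀ τ : absoluteGaloisGroup (CyclotomicField 3 ℚ),
              IsArithFrobAt (𝓞 (CyclotomicField 3 ℚ)) τ 𝔓 →
                FramedRep.trace ρ τ⁻¹ = j (picardTrace f 𝔭)) ∧
      (12 ∣ Nat.card (f.map (Int.castRingHom ℚ)).Gal → FramedRep.IsAbsolutelyIrreducible ρ) := by
  classical
  haveI : IsCyclotomicExtension {3} ℚ (CyclotomicField 3 ℚ) := CyclotomicField.isCyclotomicExtension 3 ℚ
  haveI hf4 : Fact (f.natDegree = 4) := ⟨h4⟩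
  haveI hfs : Fact (f.map (Int.castRingHom ℚ)).Separable := ⟨hsep⟩
  obtain ⟨g, hg⟩ := hg
  exact picard_exists_framedGaloisRep_of_finrank_eq_six (K := CyclotomicField 3 ℚ) (f := f) hX2 hX3
    (picard_finrank_tateModule_eq_six_of_card_fixed_mod_three_ne_one' (K := CyclotomicField 3 ℚ) (f := f)
      hX2 hX3 hg) j

/-- **Galois representations attached to Picard curves** (Upton 2009, Thm. 2.1 / §4), conditional form
with the geometric input on the Tate module cut down to NON-VANISHING: GIVEN (`hX0`) that
`T₃ Pic(C_{f,K̄}) ≠ 0` for the Picard quartics over `K ⊇ ℚ(ω)` (a shadow of `T₃ J ≅ ℤ₃⁶`, Weil/Mumford;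
implied by the divisibility input `hX1'` of
`picardCurve_exists_lambdaAdicRep_of_divisible_goodReduction_lefschetz` and needed only for the `f`
whose Galois group over `ℚ(ω)` fixes a root, cf.
`picardCurve_lambdaAdicRep_of_goodReduction_lefschetz_of_twelve_dvd`), (`hX2`) the good-reduction
datum (Serre–Tate §1 Thm. 1) and (`hX3`) the twisted Lefschetz trace formula (Milne JV Prop. 11.2), the
statement `picardCurve_exists_lambdaAdicRep` holds: the rank dichotomy
`picard_finrank_tateModule_eq_zero_or_eq_six` (Chebotarev at a totally split good prime) upgrades
`T ≠ 0` to rank `6`, i.e. to the torsion count `#J_f[3ⁿ] = 3^{6n}` of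
`picardCurve_exists_lambdaAdicRep_of_card_goodReduction_lefschetz`.
[cite: Upton2009, Thm. 2.1 and §4] [cite: SerreTate1968GoodReduction, §1, Thm. 1]
[cite: Milne1986JacobianVarieties, §11 Prop. 11.2] [cite: MumfordAV1970, §6 Application 2]
[cite: NeukirchANT1999, VII Thm. (13.4)] -/
theorem picardCurve_exists_lambdaAdicRep_of_nontrivial_goodReduction_lefschetz
    (hX0 : ∀ (K : Type) [Field K] [NumberField K] [IsCyclotomicExtension {3} ℚ K]
      (f : ℤ[X]) (h4 : f.natDegree = 4) (hsep : (f.map (Int.castRingHom ℚ)).Separable),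
      haveI := fact_irreducible_superellipticPoly_picard K h4 hsep
      Nontrivial (TateModule (GeomPic K 3 (f.map (algebraMap ℤ K))) 3))
    (hX2 : ∀ (K : Type) [Field K] [NumberField K] (p : ℕ) [Fact p.Prime] (f : K[X]) (f₀ : (𝓞 K)[X]),
      f₀.map (algebraMap (𝓞 K) K) = f →
      ∀ (𝔭 : HeightOneSpectrum (𝓞 K)) (𝔓 : Ideal (absIntegers (𝓞 K) K)) [𝔓.IsMaximal] [𝔓.LiesOver 𝔭.asIdeal],
      (p : 𝓞 K) ∉ 𝔭.asIdeal → ¬ p ∣ f.natDegree →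
      (f₀.map (Ideal.Quotient.mk 𝔭.asIdeal)).natDegree = f.natDegree →
      (f₀.map (Ideal.Quotient.mk 𝔭.asIdeal)).Separable →
      ∀ [Fact (Irreducible (superellipticPoly K (AlgebraicClosure K) p f))]
        [Fact (Irreducible (superellipticPoly (𝓞 K ⧸ 𝔭.asIdeal) (absIntegers (𝓞 K) K ⧸ 𝔓) p
          (f₀.map (Ideal.Quotient.mk 𝔭.asIdeal))))],
      ∃ red : GeomPic K p f →+
          SuperellipticPic (𝓞 K ⧸ 𝔭.asIdeal) (absIntegers (𝓞 K) K ⧸ 𝔓) p (f₀.map (Ideal.Quotient.mk 𝔭.asIdeal)),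
        (∀ (τ : MulAction.stabilizer (absoluteGaloisGroup K) 𝔓) (c : GeomPic K p f),
            red ((τ : absoluteGaloisGroup K) • c) =
              (Ideal.Quotient.stabilizerHom 𝔓 𝔭.asIdeal (absoluteGaloisGroup K) τ) • red c) ∧
        (∀ (ζ : CyclicCoverDeck (AlgebraicClosure K) p) (c : GeomPic K p f),
            red (ζ • c) = CyclicCoverDeck.reduceMod K p 𝔓 ζ • red c) ∧
        (∀ N : ℕ, (N : 𝓞 K ⧸ 𝔭.asIdeal) ≠ 0 →
          (∀ c : GeomPic K p f, N • c = 0 → red c = 0 → c = 0) ∧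
          (∀ c', N • c' = 0 → ∃ c : GeomPic K p f, N • c = 0 ∧ red c = c')))
    (hX3 : ∀ (k : Type) [Field k] [Fintype k] (Ω : Type) [Field Ω] [Algebra k Ω] [IsAlgClosed Ω]
      [Algebra.IsAlgebraic k Ω] (p : ℕ) [Fact p.Prime] (ℓ : ℕ) [Fact ℓ.Prime] (f : k[X]),
      (p : k) ≠ 0 → (ℓ : k) ≠ 0 → f.Separable → ¬ p ∣ f.natDegree →
      ∀ [Fact (Irreducible (superellipticPoly k Ω p f))] (φ : Ω ≃ₐ[k] Ω), (∀ x : Ω, φ x = x ^ Fintype.card k) →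
      ∀ (ξ : CyclicCoverDeck Ω p),
        LinearMap.trace ℚ_[ℓ] (RationalTateModule (SuperellipticPic k Ω p f) ℓ)
          (rationalTateRepresentation (Ω ≃ₐ[k] Ω) (SuperellipticPic k Ω p f) ℓ φ ∘ₗ
            rationalTateRepresentation (CyclicCoverDeck Ω p) (SuperellipticPic k Ω p f) ℓ ξ) =
          (Fintype.card k : ℚ_[ℓ]) + 1 -
            Nat.card {P : PlaceOver Ω (SuperellipticFunctionField k Ω p f) // φ • (ξ • P) = P}) :
    picardCurve_exists_lambdaAdicRep := by
  intro f h4 hsep j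
  classical
  haveI : IsCyclotomicExtension {3} ℚ (CyclotomicField 3 ℚ) := CyclotomicField.isCyclotomicExtension 3 ℚ
  haveI hf4 : Fact (f.natDegree = 4) := ⟨h4⟩
  haveI hfs : Fact (f.map (Int.castRingHom ℚ)).Separable := ⟨hsep⟩
  haveI := hX0 (CyclotomicField 3 ℚ) f h4 hsep
  exact picard_exists_framedGaloisRep_of_finrank_eq_six (K := CyclotomicField 3 ℚ) (f := f) hX2 hX3
    (picard_finrank_tateModule_eq_six_of_nontrivial (K := CyclotomicField 3 ℚ) (f := f) hX2 hX3) j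

end Literature.NumberTheory.GaloisRepresentations
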